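import Literature.Geometry.Lorentzian.DocStructureTimeFunction
import Literature.Geometry.Lorentzian.KillingFlowIsometry
import Literature.Geometry.Lorentzian.StationaryBlackHoleUniquenessProofs
import Literature.Geometry.Lorentzian.DocOrbitsMeetHypersurface
import Literature.Geometry.Lorentzian.DocStationarySpacetime
import Literature.Analysis.Calculus.ParametricCrossingTime
import Literature.Analysis.FunctionSpaces.SmoothParametricIntegral
import Literature.Geometry.Lorentzian.GlobalHyperbolicityTimeFunction
import HarnessLib

/-!
# Chruściel–Costa 2008, Thm. 4.5 — proofs file: the time function of a spacelike flow section
(the closing paragraph of the proof of the structure theorem, §4.2, p. 15 of arXiv:0806.0016)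

Companion (proofs-only) file of `Literature.Geometry.Lorentzian.DocStructureTimeFunction`, which
vendors the time-function part of Chruściel–Costa's structure theorem (Astérisque 321 (2008)
195–265 = arXiv:0806.0016, §4.2, Thm. 4.5) as the named facts
`chruscielCosta2008_equivariantTimeFunction` and `chruscielCosta2008_spacelikeTimeFunction`.

The printed proof of Thm. 4.5 constructs (Prop. 4.4, Prop. 4.6 = Wald's averaging, the
cone-widened metrics `g_ε`, the Lipschitz hypersurfaces `C⁺_ε` and their mollification,
Lemmas 4.7–4.9) a smooth spacelike hypersurface `𝒮₀ ⊆ ⟨⟨M_ext⟩⟩` transverse to the stationary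
Killing field `K₀` and met exactly once by every Killing orbit, and then concludes (last
paragraph of the proof, p. 15): "the function `t(p)` is defined now as the unique value of
parameter `t` so that `φ_t(p) ∈ 𝒮₀`; since the level sets of `t` are smooth spacelike
hypersurface[s], `t` is a smooth time function."  This file proves that concluding step, for an
arbitrary complete flow on a manifold and then for the stationary flow of a
`StationaryAFBlackHole`, and records the resulting reduction of the named fact
`chruscielCosta2008_spacelikeTimeFunction` to the existence of such a section `𝒮₀`:

* `crossParam_flow` — if every orbit of the flow `θ` through the invariant set `D` meets `S`
  exactly once, at parameter `σ p` (`θ (σ p, p) ∈ S`), then `σ (θ (r, p)) = σ p - r`: the function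
  `t := -σ` satisfies `t ∘ φ_r = t + r` ("the flow of `K₀` is a translation along the `ℝ` factor");
* `contMDiffAt_crossParam`, `contMDiffAt_crossParam_infty` — **`σ` is `C^∞` on `D`**: about
  `p₀ ∈ D`, with `S = {f = 0}` near `x₀ = θ (σ p₀, p₀)` and `df(X) ≠ 0` at `x₀` (transversality of
  the section to the generator `X` of the flow), the implicit-function theorem for the scalar
  equation `f (θ (s, p)) = 0` (`Literature.Analysis.Calculus.exists_contDiffOn_crossingTime`, read
  in a chart) produces a smooth local solution `s = R(p)` which, by the uniqueness of the crossing
  parameter, is `σ`;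
* `mfderiv_crossParam_ne_zero` — **the level sets of `σ` are as spacelike as `S`**:
  differentiating `f (θ (σ p, p)) = 0` gives `dσ(k) · df(X) + df(dθ_{σ p₀} k) = 0`, so `dσ_{p₀}(k) ≠ 0`
  for every vector `k` whose flow-transport `dθ_{σ p₀} k` is not annihilated by `df` — for an
  isometric flow and `df` a timelike covector on `S`, every non-zero causal `k`;
* `StationaryAFBlackHole.exists_spacelikeTimeFunction_of_section` — for a stationary
  asymptotically flat black hole and its stationary flow (`exists_stationary_flow`: smooth, by
  time-orientation-preserving isometries, `⟨⟨M_ext⟩⟩` invariant): **a smooth spacelike flow section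
  of `⟨⟨M_ext⟩⟩` yields a function `t`, `C^∞` on `⟨⟨M_ext⟩⟩`, with `t (γ s) = t (γ 0) + s` along every
  Killing orbit from `⟨⟨M_ext⟩⟩` and `dt_x(k) ≠ 0` for all non-zero causal `k`** — the three clauses
  of `chruscielCosta2008_spacelikeTimeFunction`;
* `chruscielCosta2008_spacelikeTimeFunction_of_sections` — hence the named fact follows from the
  existence, for every vacuum `I⁺`-regular `𝓑`, of such a section (the content of §4.2 up to its
  last paragraph: Prop. 4.4, Prop. 4.6, the `g_ε`/`C⁺_ε` smoothing and the extension at large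
  distances, together with the one-end reduction of Thm. 2.3; none of these is in the tree);
* `exists_localDefiningFunction_of_isSmoothEmbedding`,
  `PseudoRiemannianMetric.IsSpacelikeImmersion.exists_localDefiningFunction` — an embedded
  (spacelike) hypersurface is locally a regular zero locus `{h = 0}` with `ker dh = T S`
  (spacelike), from the slice charts of `Manifold.IsImmersionAt` (Lee 2012, Thm. 5.8,
  Prop. 5.16);
* `StationaryAFBlackHole.IPlusRegularHypersurface.exists_spacelikeTimeFunction_of_isTimelike` —
  **the strictly stationary case of the fact**: if `K` is timelike on all of `⟨⟨M_ext⟩⟩` (no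
  ergoregion; e.g. the static case after the Vishveshwara–Carter lemma), the hypersurface `S` of
  Def. 1.1 is itself a spacelike section of the flow — its orbits are future timelike curves, so
  they meet the acausal `S` at most once, and at least once granted the partition
  `⟨⟨M_ext⟩⟩ ⊆ I⁺(S) ∪ S ∪ I⁻(S)` (`DocOrbitsMeetHypersurface.lean`, hypothesis `hpart`) — and the
  three clauses of `chruscielCosta2008_spacelikeTimeFunction` hold for `𝓑`;
* `eventually_exists_flow_mem` (orbits near an orbit crossing a transverse hypersurface cross
  it), `IPlusRegularHypersurface.exists_flow_mem_carrierSet_of_isTimelike` — **every orbit through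
  `⟨⟨M_ext⟩⟩` meets `S`, proved without the partition hypothesis when `K` is timelike on
  `⟨⟨M_ext⟩⟩`** (the flow saturation of `S` is open by transversality, and relatively closed in
  the connected `⟨⟨M_ext⟩⟩` because crossing parameters are locally bounded: the flow maps preserve
  `≪` and `S` is achronal), whence `IPlusRegularHypersurface.doc_subset_of_isTimelike` — the
  partition `⟨⟨M_ext⟩⟩ ⊆ I⁺(S) ∪ S ∪ I⁻(S)` itself in that case — and the UNCONDITIONAL strictly
  stationary case of the fact, `IPlusRegularHypersurface.exists_spacelikeTimeFunction_of_isTimelike'`,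
  `IsIPlusRegular.exists_spacelikeTimeFunction_of_isTimelike`;
* `contMDiffAt_intervalIntegral` — `p ↦ ∫ₐᵇ g (s, p) ds` is `C^∞` at `p₀` when `g` is `C^∞` near
  `[[a, b]] × {p₀}` (charts, a cutoff, and `contDiff_parametric_intervalIntegral` of
  `Literature/Analysis/FunctionSpaces/SmoothParametricIntegral.lean`);
* `exists_wald_averaging_function`, `exists_flowSection_of_uniformTransit` — **Prop. 4.6 (Wald's
  averaging construction)**, for manifolds without boundary: given a smooth complete flow, a smooth
  `f : M → [0, 1]` vanishing on `M₋` and equal to `1` on `M₊`, and a uniform bound `T` on the transit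
  time of orbits from `M₋` to `M₊`, the function `F (p) = ∫_{-∞}^0 f (φ_s p) ds` is `C^∞`,
  non-decreasing along orbits with `(d/ds) F (φ_s p)|₀ = f (p)`, and `S₁ = {F = T}` is a smooth
  hypersurface transverse to the flow met exactly once by every orbit (the first step of the
  construction of `𝒮₀` in the proof of Thm. 4.5);
* `StationaryAFBlackHole.IsIPlusRegular.exists_continuousOn_retardedTime` — **the retarded Killing
  time**: on an `I⁺`-regular `⟨⟨M_ext⟩⟩` the function `u(p) = sup {t | p ∈ I⁺(φ_t(q₀))}` (`q₀ ∈ M_ext`)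
  is real-valued, continuous, flow-equivariant (`u ∘ φ_s = u + s`) and isotone for the causal
  relation — the function `u` of (4.14) built from a point of `M_ext` instead of the sphere
  `Ŝ_{0,R}`, which needs neither Prop. 4.4 nor the one-end hypothesis (strong causality and the
  compact causal diamonds of Def. 1.1 replace them);
* `mvfderiv_intervalIntegral_apply` — differentiation under the integral sign on a manifold,
  `d(∫ₐᵇ g (s, ·) ds)(v) = ∫ₐᵇ d(g (s, ·))(v) ds`, and `flowAverage` — the flow average
  `t̄ = ∫₀ᵀ τ' ∘ θ_s ds` of a function smooth on an invariant open set: smooth, with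
  `dt̄ (v) = ∫₀ᵀ dτ' (dθ_s v) ds` and `(d/dr) t̄ (θ_r p)|₀ = τ' (θ_T p) - τ' (p)`;
* `chruscielCosta2008_spacelikeTimeFunction_of_timeFunction_approx` — **the named fact reduced to
  two classical theorems of causality theory** (a time function on Hawking–Ellis globally
  hyperbolic open sets, Geroch 1970 / Hawking–Ellis Prop. 6.6.8; uniform approximation of causal
  functions by smooth temporal functions, Bernard–Suhr 2018, Cor. 9): the retarded Killing time is
  approximated by a smooth temporal function, whose flow average has positive Killing derivative
  and timelike differential, so that its zero level set is the required spacelike section.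

Everything here is proved; no definitions and no named facts are introduced (D-0026).  The
tree already holds the other elementary steps of the printed proof: the flow by isometries
(`KillingFlowIsometry.lean`), §3 (`StationaryBlackHoleUniquenessProofs.lean`) and "every orbit
meets `S`" modulo the partition of `⟨⟨M_ext⟩⟩` by `S` (`DocOrbitsMeetHypersurface.lean`).

## References

* P. T. Chruściel, J. L. Costa, *On uniqueness of stationary vacuum black holes*, Astérisque 321
  (2008) 195–265, arXiv:0806.0016, §4.2, Thm. 4.5 and its proof (pp. 13–15), Prop. 4.6
  (key `ChruscielCosta2008`).
* J. M. Lee, *Introduction to Smooth Manifolds*, 2nd ed., GTM 218 (2012), Thm. 5.8 and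
  Prop. 5.16 (slice charts, local defining functions), Thm. 9.12 (flows), Thm. C.40 (implicit
  function theorem) (key `LeeSmoothManifolds2013`).
* S. W. Hawking, G. F. R. Ellis, *The Large Scale Structure of Space-Time* (1973), §6.6,
  Prop. 6.6.8 (key `HawkingEllis1973CUP`); R. Geroch, *Domain of dependence*, J. Math. Phys. 11
  (1970) 437–449 (key `Geroch1970`); E. Minguzzi, *Lorentzian causality theory*, Living Rev.
  Relativ. 22 (2019) 3, Thm. 4.119 (key `Minguzzi2019LRR`).
* P. Bernard, S. Suhr, *Smoothing causal functions*, J. Phys.: Conf. Ser. 968 (2018) 012001 =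
  arXiv:1711.03883, Cor. 9 (key `BernardSuhr2018`).
-/

noncomputable section

open Bundle Set Function Filter Manifold Module
open scoped Manifold ContDiff Topology

namespace Literature.Geometry.Lorentzian

universe u

/-! ### The crossing parameter of a flow section -/

section FlowSection

variable {M : Type*} {θ : ℝ × M → M} {D S : Set M} {σ : M → ℝ}

/-- **Equivariance of the crossing parameter.** Let `θ` be a flow with the group law, `D` a
`θ`-invariant set and `S` a set met exactly once by the orbit of every point of `D`, at the
parameter `σ`: `θ (σ p, p) ∈ S` and `θ (s, p) ∈ S → s = σ p`. Then `σ (θ (r, p)) = σ p - r`, i.e.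
`t := -σ` satisfies `t (φ_r p) = t p + r`. Chruściel–Costa 2008, §4.2 ((4.14):
"`u (φ_t(p)) = u (p) + t`"). [cite: ChruscielCosta2008, §4.2 (4.14)] -/
theorem crossParam_flow (hθadd : ∀ t s p, θ (t, θ (s, p)) = θ (t + s, p))
    (hDinv : ∀ (s : ℝ) (p : M), p ∈ D → θ (s, p) ∈ D) (hσ : ∀ p ∈ D, θ (σ p, p) ∈ S)
    (huniq : ∀ p ∈ D, ∀ s : ℝ, θ (s, p) ∈ S → s = σ p) {p : M} (hp : p ∈ D) (r : ℝ) :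
    σ (θ (r, p)) = σ p - r := by
  have h1 : θ (σ p - r, θ (r, p)) ∈ S := by
    rw [hθadd, sub_add_cancel]
    exact hσ p hp
  exact (huniq _ (hDinv r p hp) _ h1).symm

variable {E : Type*} [NormedAddCommGroup E] [NormedSpace ℝ E] {H : Type*}
  [TopologicalSpace H] {I : ModelWithCorners ℝ E H} [TopologicalSpace M] [ChartedSpace H M]
  {X : Π x : M, TangentSpace I x}

/-- The velocity of a flow line is the generating field: the partial derivative of `θ` in the
flow parameter is `dθ_{(s, p)}(a, 0) = a • X (θ (s, p))`. Lee 2012, Prop. 9.11 ff. [folklore] -/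
theorem mfderiv_flow_curve_apply (hθX : ∀ p, IsMIntegralCurve (fun t ↦ θ (t, p)) X) (s : ℝ)
    (p : M) (a : ℝ) :
    mfderiv 𝓘(ℝ, ℝ) I (fun t ↦ θ (t, p)) s a = a • X (θ (s, p)) := by
  rw [(hθX p s).mfderiv]
  rfl

/-- The derivative of a function along a flow line: `(d/ds) f (θ (s, p)) = df (X (θ (s, p)))`.
[folklore] -/
theorem hasDerivAt_comp_flow_curve (hθX : ∀ p, IsMIntegralCurve (fun t ↦ θ (t, p)) X)
    {f : M → ℝ} {s : ℝ} {p : M} (hf : MDifferentiableAt I 𝓘(ℝ, ℝ) f (θ (s, p))) :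
    HasDerivAt (fun t ↦ f (θ (t, p))) (mfderiv I 𝓘(ℝ, ℝ) f (θ (s, p)) (X (θ (s, p)))) s := by
  simpa [velocity_eq_of_isMIntegralCurve (hθX p)] using
    hasDerivAt_comp_curve hf (hθX p s).mdifferentiableAt

variable [CompleteSpace E] [I.Boundaryless] [IsManifold I ∞ M]

/-- **The crossing parameter is `Cⁿ`** (every finite `n`). Let `θ` be a `C^∞` complete flow of
`X` (group law), `D` an open `θ`-invariant set, and `S` a set met exactly once, at parameter
`σ p`, by the orbit of each `p ∈ D`; suppose that about every point `x ∈ S` there are an open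
`U ∋ x` and a function `f`, `C^∞` at `x`, with `S ∩ U = {f = 0} ∩ U` and `df_x (X x) ≠ 0` (the
section is a smooth hypersurface transverse to the flow). Then `σ` is `Cⁿ` at every point of `D`:
in a chart about `p₀` the equation `f (θ (s, p)) = 0` has, by the implicit function theorem
(`exists_contDiffOn_crossingTime`), a `Cⁿ` local solution `s = R (p)` near `(σ p₀, p₀)`, and
`R = σ` by uniqueness of the crossing. This is the smoothness assertion of the last paragraph of
the proof of Chruściel–Costa 2008, Thm. 4.5 ("`t` is a smooth time function"). [cite: ChruscielCosta2008, Thm. 4.5 (proof, last paragraph)] -/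
theorem contMDiffAt_crossParam {C : ∀ x : M, TangentSpace I x → Prop}
    (hθ : ContMDiff (𝓘(ℝ, ℝ).prod I) I ∞ θ)
    (hθX : ∀ p, IsMIntegralCurve (fun t ↦ θ (t, p)) X) (hD : IsOpen D)
    (hσ : ∀ p ∈ D, θ (σ p, p) ∈ S) (huniq : ∀ p ∈ D, ∀ s : ℝ, θ (s, p) ∈ S → s = σ p)
    (hloc : ∀ x ∈ S, ∃ (f : M → ℝ) (U : Set M), IsOpen U ∧ x ∈ U ∧
      ContMDiffAt I 𝓘(ℝ, ℝ) ∞ f x ∧ (∀ y ∈ U, y ∈ S ↔ f y = 0) ∧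
      mfderiv I 𝓘(ℝ, ℝ) f x (X x) ≠ 0 ∧ ∀ k : TangentSpace I x, C x k → mfderiv I 𝓘(ℝ, ℝ) f x k ≠ 0)
    {p₀ : M} (hp₀ : p₀ ∈ D) (n : ℕ) :
    ContMDiffAt I 𝓘(ℝ, ℝ) n σ p₀ := by
  obtain ⟨f, U, hUo, hx₀U, hf, hUS, hfX, -⟩ := hloc _ (hσ p₀ hp₀)
  -- the chart at `p₀` and the chart expression `g z s = f (θ (s, φ⁻¹ z))`
  have hz₀ : (extChartAt I p₀).symm (extChartAt I p₀ p₀) = p₀ := extChartAt_to_inv p₀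
  have hsymm : ContMDiffAt 𝓘(ℝ, E) I ∞ (extChartAt I p₀).symm (extChartAt I p₀ p₀) :=
    (contMDiffOn_extChartAt_symm p₀).contMDiffAt (extChartAt_target_mem_nhds p₀)
  have hA : ContMDiffAt (𝓘(ℝ, E).prod 𝓘(ℝ, ℝ)) (𝓘(ℝ, ℝ).prod I) ∞
      (fun q : E × ℝ ↦ (q.2, (extChartAt I p₀).symm q.1)) (extChartAt I p₀ p₀, σ p₀) :=
    contMDiffAt_snd.prodMk (hsymm.comp (extChartAt I p₀ p₀, σ p₀) contMDiffAt_fst)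
  have hB : ContMDiffAt (𝓘(ℝ, E).prod 𝓘(ℝ, ℝ)) I ∞
      (fun q : E × ℝ ↦ θ (q.2, (extChartAt I p₀).symm q.1)) (extChartAt I p₀ p₀, σ p₀) :=
    hθ.contMDiffAt.comp (extChartAt I p₀ p₀, σ p₀) hA
  have hkey : θ (σ p₀, (extChartAt I p₀).symm (extChartAt I p₀ p₀)) = θ (σ p₀, p₀) := by
    rw [hz₀]
  have hf' : ContMDiffAt I 𝓘(ℝ, ℝ) ∞ f
      (θ (σ p₀, (extChartAt I p₀).symm (extChartAt I p₀ p₀))) := by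
    rw [hkey]; exact hf
  set g : E → ℝ → ℝ := fun z s ↦ f (θ (s, (extChartAt I p₀).symm z)) with hg_def
  have hC : ContMDiffAt (𝓘(ℝ, E).prod 𝓘(ℝ, ℝ)) 𝓘(ℝ, ℝ) ∞ (uncurry g)
      (extChartAt I p₀ p₀, σ p₀) := hf'.comp (extChartAt I p₀ p₀, σ p₀) hB
  have hC' : ContMDiffAt 𝓘(ℝ, E × ℝ) 𝓘(ℝ, ℝ) ∞ (uncurry g) (extChartAt I p₀ p₀, σ p₀) := by
    rw [modelWithCornersSelf_prod, ← chartedSpaceSelf_prod]; exact hC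
  have hg : ContDiffAt ℝ ((n + 1 : ℕ) : ℕ∞ω) (uncurry g) (extChartAt I p₀ p₀, σ p₀) :=
    (contMDiffAt_iff_contDiffAt.1 hC').of_le (by exact_mod_cast le_top)
  -- transversality: `∂_s g (z₀, s₀) = df (X x₀) ≠ 0`
  have hspeed : deriv (g (extChartAt I p₀ p₀)) (σ p₀) ≠ 0 := by
    have hgz₀ : g (extChartAt I p₀ p₀) = fun s ↦ f (θ (s, p₀)) := by
      funext s; simp only [hg_def, hz₀]
    rw [hgz₀, (hasDerivAt_comp_flow_curve hθX (hf.mdifferentiableAt (by simp))).deriv]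
    exact hfX
  -- the implicit function
  obtain ⟨ε, hε, η, -, R, hR, hR₀, hRg, -⟩ :=
    Literature.Analysis.Calculus.exists_contDiffOn_crossingTime (n := ((n + 1 : ℕ) : ℕ∞ω))
      (by simp) (by simp) hg hspeed
  have hRz₀ : ContDiffAt ℝ ((n + 1 : ℕ) : ℕ∞ω) R (extChartAt I p₀ p₀) :=
    hR.contDiffAt (Metric.ball_mem_nhds _ hε)
  -- the good neighbourhood of `z₀`
  have hW₁ : ∀ᶠ z in 𝓝 (extChartAt I p₀ p₀), z ∈ Metric.ball (extChartAt I p₀ p₀) ε :=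
    Metric.ball_mem_nhds _ hε
  have hW₂ : ∀ᶠ z in 𝓝 (extChartAt I p₀ p₀), (extChartAt I p₀).symm z ∈ D :=
    (continuousAt_extChartAt_symm p₀).preimage_mem_nhds (hD.mem_nhds (by rwa [hz₀]))
  have hW₃ : ∀ᶠ z in 𝓝 (extChartAt I p₀ p₀), θ (R z, (extChartAt I p₀).symm z) ∈ U := by
    have hc : ContinuousAt (fun z ↦ θ (R z, (extChartAt I p₀).symm z)) (extChartAt I p₀ p₀) :=
      hθ.continuous.continuousAt.comp
        (hRz₀.continuousAt.prodMk (continuousAt_extChartAt_symm p₀))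
    refine hc.preimage_mem_nhds (hUo.mem_nhds ?_)
    show θ (R (extChartAt I p₀ p₀), (extChartAt I p₀).symm (extChartAt I p₀ p₀)) ∈ U
    rwa [hR₀, hz₀]
  -- on it, `σ ∘ φ⁻¹ = R`
  have h0 : f (θ (σ p₀, p₀)) = 0 := (hUS _ hx₀U).1 (hσ p₀ hp₀)
  have hEq : ∀ᶠ z in 𝓝 (extChartAt I p₀ p₀), σ ((extChartAt I p₀).symm z) = R z := by
    filter_upwards [hW₁, hW₂, hW₃] with z hzb hzD hzU
    have h1 : f (θ (R z, (extChartAt I p₀).symm z)) = 0 := by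
      have h2 := (hRg z hzb).2
      simp only [hg_def, hz₀] at h2
      exact h2.trans h0
    exact (huniq _ hzD _ ((hUS _ hzU).2 h1)).symm
  -- hence `σ = R ∘ φ` near `p₀`
  have hEq' : σ =ᶠ[𝓝 p₀] R ∘ extChartAt I p₀ := by
    have h1 : ∀ᶠ p in 𝓝 p₀, p ∈ (extChartAt I p₀).source := extChartAt_source_mem_nhds p₀
    have h2 : ∀ᶠ p in 𝓝 p₀,
        σ ((extChartAt I p₀).symm (extChartAt I p₀ p)) = R (extChartAt I p₀ p) :=
      (continuousAt_extChartAt p₀).eventually hEq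
    filter_upwards [h1, h2] with p hp hp'
    rwa [(extChartAt I p₀).left_inv hp] at hp'
  have hRφ : ContMDiffAt I 𝓘(ℝ, ℝ) ((n + 1 : ℕ) : ℕ∞ω) (R ∘ extChartAt I p₀) p₀ :=
    (contMDiffAt_iff_contDiffAt.2 hRz₀).comp p₀ contMDiffAt_extChartAt
  exact (hRφ.congr_of_eventuallyEq hEq').of_le (by exact_mod_cast Nat.le_succ n)

/-- `C^∞` form of `contMDiffAt_crossParam`: the crossing parameter of a smooth transverse flow
section is smooth. [cite: ChruscielCosta2008, Thm. 4.5 (proof, last paragraph)] -/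
theorem contMDiffAt_crossParam_infty {C : ∀ x : M, TangentSpace I x → Prop}
    (hθ : ContMDiff (𝓘(ℝ, ℝ).prod I) I ∞ θ)
    (hθX : ∀ p, IsMIntegralCurve (fun t ↦ θ (t, p)) X) (hD : IsOpen D)
    (hσ : ∀ p ∈ D, θ (σ p, p) ∈ S) (huniq : ∀ p ∈ D, ∀ s : ℝ, θ (s, p) ∈ S → s = σ p)
    (hloc : ∀ x ∈ S, ∃ (f : M → ℝ) (U : Set M), IsOpen U ∧ x ∈ U ∧
      ContMDiffAt I 𝓘(ℝ, ℝ) ∞ f x ∧ (∀ y ∈ U, y ∈ S ↔ f y = 0) ∧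
      mfderiv I 𝓘(ℝ, ℝ) f x (X x) ≠ 0 ∧ ∀ k : TangentSpace I x, C x k → mfderiv I 𝓘(ℝ, ℝ) f x k ≠ 0)
    {p₀ : M} (hp₀ : p₀ ∈ D) :
    ContMDiffAt I 𝓘(ℝ, ℝ) ∞ σ p₀ :=
  contMDiffAt_infty.2 fun n ↦ contMDiffAt_crossParam hθ hθX hD hσ huniq hloc hp₀ n

/-- **The level sets of the crossing parameter are transverse to the cone `C`.** In the setting
of `contMDiffAt_crossParam`, suppose moreover that the defining functions `f` of the section have
`df_x(k) ≠ 0` for all `k` in a cone `C x ⊆ T_x M` at the points `x ∈ S`, and that `C` is invariant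
under the differentials of the flow maps. Then `dσ_{p₀}(k) ≠ 0` for every `k ∈ C p₀`, `p₀ ∈ D`:
differentiating `f (θ (σ p, p)) = 0` at `p₀` gives `dσ(k) · df(X) + df(dθ_{σ p₀} k) = 0`. With `C`
the non-zero causal vectors of a Lorentzian metric, an isometric flow and spacelike sections
(`df` timelike), this says that the level sets of `σ` — the flow translates of the section — are
spacelike: "since the level sets of `t` are smooth spacelike hypersurfaces, `t` is a smooth time
function", Chruściel–Costa 2008, proof of Thm. 4.5, last paragraph. [cite: ChruscielCosta2008, Thm. 4.5 (proof, last paragraph)] -/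
theorem mfderiv_crossParam_ne_zero {C : ∀ x : M, TangentSpace I x → Prop}
    (hθ : ContMDiff (𝓘(ℝ, ℝ).prod I) I ∞ θ)
    (hθX : ∀ p, IsMIntegralCurve (fun t ↦ θ (t, p)) X) (hD : IsOpen D)
    (hσ : ∀ p ∈ D, θ (σ p, p) ∈ S) (huniq : ∀ p ∈ D, ∀ s : ℝ, θ (s, p) ∈ S → s = σ p)
    (hloc : ∀ x ∈ S, ∃ (f : M → ℝ) (U : Set M), IsOpen U ∧ x ∈ U ∧
      ContMDiffAt I 𝓘(ℝ, ℝ) ∞ f x ∧ (∀ y ∈ U, y ∈ S ↔ f y = 0) ∧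
      mfderiv I 𝓘(ℝ, ℝ) f x (X x) ≠ 0 ∧ ∀ k : TangentSpace I x, C x k → mfderiv I 𝓘(ℝ, ℝ) f x k ≠ 0)
    (hC : ∀ (s : ℝ) (p : M) (k : TangentSpace I p), C p k →
      C (θ (s, p)) (mfderiv I I (fun q ↦ θ (s, q)) p k))
    {p₀ : M} (hp₀ : p₀ ∈ D) {k : TangentSpace I p₀} (hk : C p₀ k) :
    mfderiv I 𝓘(ℝ, ℝ) σ p₀ k ≠ 0 := by
  obtain ⟨f, U, hUo, hx₀U, hf, hUS, -, hfC⟩ := hloc _ (hσ p₀ hp₀)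
  have hσs : ContMDiffAt I 𝓘(ℝ, ℝ) ∞ σ p₀ :=
    contMDiffAt_crossParam_infty hθ hθX hD hσ huniq hloc hp₀
  have hσd : MDifferentiableAt I 𝓘(ℝ, ℝ) σ p₀ := hσs.mdifferentiableAt (by simp)
  have hθd : MDifferentiableAt (𝓘(ℝ, ℝ).prod I) I θ (σ p₀, p₀) := hθ.mdifferentiableAt (by simp)
  have hfd : MDifferentiableAt I 𝓘(ℝ, ℝ) f (θ (σ p₀, p₀)) := hf.mdifferentiableAt (by simp)
  -- `p ↦ f (θ (σ p, p))` is constant near `p₀`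
  have hev : (fun p ↦ f (θ (σ p, p))) =ᶠ[𝓝 p₀] fun _ ↦ f (θ (σ p₀, p₀)) := by
    have h0 : f (θ (σ p₀, p₀)) = 0 := (hUS _ hx₀U).1 (hσ p₀ hp₀)
    have h1 : ∀ᶠ p in 𝓝 p₀, p ∈ D := hD.mem_nhds hp₀
    have hc : ContinuousAt (fun p ↦ θ (σ p, p)) p₀ :=
      hθ.continuous.continuousAt.comp (hσs.continuousAt.prodMk continuousAt_id)
    have h2 : ∀ᶠ p in 𝓝 p₀, θ (σ p, p) ∈ U := hc.preimage_mem_nhds (hUo.mem_nhds hx₀U)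
    filter_upwards [h1, h2] with p hp hpU
    rw [h0]
    exact (hUS _ hpU).1 (hσ p hp)
  have hzero : HasMFDerivAt I 𝓘(ℝ, ℝ) (fun p ↦ f (θ (σ p, p))) p₀
      (0 : TangentSpace I p₀ →L[ℝ] TangentSpace 𝓘(ℝ, ℝ) (f (θ (σ p₀, p₀)))) :=
    (hasMFDerivAt_const (I := I) (I' := 𝓘(ℝ, ℝ)) (f (θ (σ p₀, p₀))) p₀).congr_of_eventuallyEq
      hev
  -- chain rule for `f ∘ θ ∘ (σ, id)`
  have hΨ : HasMFDerivAt I (𝓘(ℝ, ℝ).prod I) (fun p ↦ (σ p, p)) p₀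
      ((mfderiv I 𝓘(ℝ, ℝ) σ p₀).prod (ContinuousLinearMap.id ℝ (TangentSpace I p₀))) :=
    hσd.hasMFDerivAt.prodMk (hasMFDerivAt_id p₀)
  have hθΨ : HasMFDerivAt I I (fun p ↦ θ (σ p, p)) p₀
      ((mfderiv (𝓘(ℝ, ℝ).prod I) I θ (σ p₀, p₀)).comp
        ((mfderiv I 𝓘(ℝ, ℝ) σ p₀).prod (ContinuousLinearMap.id ℝ (TangentSpace I p₀)))) :=
    HasMFDerivAt.comp p₀ (f := fun p ↦ (σ p, p)) hθd.hasMFDerivAt hΨ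
  have hchain : HasMFDerivAt I 𝓘(ℝ, ℝ) (fun p ↦ f (θ (σ p, p))) p₀
      ((mfderiv I 𝓘(ℝ, ℝ) f (θ (σ p₀, p₀))).comp
        ((mfderiv (𝓘(ℝ, ℝ).prod I) I θ (σ p₀, p₀)).comp
          ((mfderiv I 𝓘(ℝ, ℝ) σ p₀).prod (ContinuousLinearMap.id ℝ (TangentSpace I p₀))))) :=
    HasMFDerivAt.comp p₀ (f := fun p ↦ θ (σ p, p)) hfd.hasMFDerivAt hθΨ
  have e : mfderiv I 𝓘(ℝ, ℝ) f (θ (σ p₀, p₀))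
      (mfderiv (𝓘(ℝ, ℝ).prod I) I θ (σ p₀, p₀)
        ((show ℝ from mfderiv I 𝓘(ℝ, ℝ) σ p₀ k), k)) = 0 := by
    exact congrArg (fun L ↦ L k) (hasMFDerivAt_unique hchain hzero)
  have hsplit : mfderiv (𝓘(ℝ, ℝ).prod I) I θ (σ p₀, p₀)
      ((show ℝ from mfderiv I 𝓘(ℝ, ℝ) σ p₀ k), k) =
      (show ℝ from mfderiv I 𝓘(ℝ, ℝ) σ p₀ k) • X (θ (σ p₀, p₀)) +
        mfderiv I I (fun q ↦ θ (σ p₀, q)) p₀ k := by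
    rw [mfderiv_prod_eq_add_apply hθd, mfderiv_flow_curve_apply hθX]
  intro hk0
  have ha : (show ℝ from mfderiv I 𝓘(ℝ, ℝ) σ p₀ k) = (0 : ℝ) := hk0
  rw [hsplit, ha, zero_smul, zero_add] at e
  exact hfC _ (hC (σ p₀) p₀ k hk) e

end FlowSection

section FlowSection2

variable {M : Type*} {θ : ℝ × M → M} {S : Set M}
  {E : Type*} [NormedAddCommGroup E] [NormedSpace ℝ E] {H : Type*}
  [TopologicalSpace H] {I : ModelWithCorners ℝ E H} [TopologicalSpace M] [ChartedSpace H M]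
  {X : Π x : M, TangentSpace I x} [CompleteSpace E] [I.Boundaryless] [IsManifold I ∞ M]

/-- **Orbits near an orbit crossing a transverse hypersurface also cross it.** Let `θ` be a `C^∞`
flow of `X` and `S` a set which near `x₀ = θ (s₀, q₀) ∈ S` is the zero set of a function `f`,
`C^∞` at `x₀`, with `df(X x₀) ≠ 0`. Then the orbit of every `q` near `q₀` meets `S` (at a parameter
near `s₀`): the implicit function theorem for `f (θ (s, q)) = 0`
(`exists_contDiffOn_crossingTime`, read in a chart). Lee 2012, Thm. 9.20 (flowout) /
Thm. C.40. [cite: LeeSmoothManifolds2013, Thm. C.40] -/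
theorem eventually_exists_flow_mem (hθ : ContMDiff (𝓘(ℝ, ℝ).prod I) I ∞ θ)
    (hθX : ∀ p, IsMIntegralCurve (fun t ↦ θ (t, p)) X) {f : M → ℝ} {U : Set M} (hUo : IsOpen U)
    {s₀ : ℝ} {q₀ : M} (hx₀U : θ (s₀, q₀) ∈ U) (hx₀S : θ (s₀, q₀) ∈ S)
    (hf : ContMDiffAt I 𝓘(ℝ, ℝ) ∞ f (θ (s₀, q₀))) (hUS : ∀ y ∈ U, y ∈ S ↔ f y = 0)
    (hfX : mfderiv I 𝓘(ℝ, ℝ) f (θ (s₀, q₀)) (X (θ (s₀, q₀))) ≠ 0) :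
    ∀ᶠ q in 𝓝 q₀, ∃ s : ℝ, θ (s, q) ∈ S := by
  -- the chart at `q₀` and the chart expression `g z s = f (θ (s, φ⁻¹ z))`
  have hz₀ : (extChartAt I q₀).symm (extChartAt I q₀ q₀) = q₀ := extChartAt_to_inv q₀
  have hsymm : ContMDiffAt 𝓘(ℝ, E) I ∞ (extChartAt I q₀).symm (extChartAt I q₀ q₀) :=
    (contMDiffOn_extChartAt_symm q₀).contMDiffAt (extChartAt_target_mem_nhds q₀)
  have hA : ContMDiffAt (𝓘(ℝ, E).prod 𝓘(ℝ, ℝ)) (𝓘(ℝ, ℝ).prod I) ∞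
      (fun q : E × ℝ ↦ (q.2, (extChartAt I q₀).symm q.1)) (extChartAt I q₀ q₀, s₀) :=
    contMDiffAt_snd.prodMk (hsymm.comp (extChartAt I q₀ q₀, s₀) contMDiffAt_fst)
  have hB : ContMDiffAt (𝓘(ℝ, E).prod 𝓘(ℝ, ℝ)) I ∞
      (fun q : E × ℝ ↦ θ (q.2, (extChartAt I q₀).symm q.1)) (extChartAt I q₀ q₀, s₀) :=
    hθ.contMDiffAt.comp (extChartAt I q₀ q₀, s₀) hA
  have hkey : θ (s₀, (extChartAt I q₀).symm (extChartAt I q₀ q₀)) = θ (s₀, q₀) := by rw [hz₀]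
  have hf' : ContMDiffAt I 𝓘(ℝ, ℝ) ∞ f (θ (s₀, (extChartAt I q₀).symm (extChartAt I q₀ q₀))) := by
    rw [hkey]; exact hf
  set g : E → ℝ → ℝ := fun z s ↦ f (θ (s, (extChartAt I q₀).symm z)) with hg_def
  have hC : ContMDiffAt (𝓘(ℝ, E).prod 𝓘(ℝ, ℝ)) 𝓘(ℝ, ℝ) ∞ (uncurry g)
      (extChartAt I q₀ q₀, s₀) := hf'.comp (extChartAt I q₀ q₀, s₀) hB
  have hC' : ContMDiffAt 𝓘(ℝ, E × ℝ) 𝓘(ℝ, ℝ) ∞ (uncurry g) (extChartAt I q₀ q₀, s₀) := by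
    rw [modelWithCornersSelf_prod, ← chartedSpaceSelf_prod]; exact hC
  have hg : ContDiffAt ℝ 1 (uncurry g) (extChartAt I q₀ q₀, s₀) :=
    (contMDiffAt_iff_contDiffAt.1 hC').of_le (by exact_mod_cast le_top)
  have hspeed : deriv (g (extChartAt I q₀ q₀)) s₀ ≠ 0 := by
    have hgz₀ : g (extChartAt I q₀ q₀) = fun s ↦ f (θ (s, q₀)) := by
      funext s; simp only [hg_def, hz₀]
    rw [hgz₀, (hasDerivAt_comp_flow_curve hθX (hf.mdifferentiableAt (by simp))).deriv]
    exact hfX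
  obtain ⟨ε, hε, η, -, R, hR, hR₀, hRg, -⟩ :=
    Literature.Analysis.Calculus.exists_contDiffOn_crossingTime (n := 1) one_ne_zero (by simp)
      hg hspeed
  have hRz₀ : ContDiffAt ℝ 1 R (extChartAt I q₀ q₀) := hR.contDiffAt (Metric.ball_mem_nhds _ hε)
  have hW₁ : ∀ᶠ z in 𝓝 (extChartAt I q₀ q₀), z ∈ Metric.ball (extChartAt I q₀ q₀) ε :=
    Metric.ball_mem_nhds _ hε
  have hW₃ : ∀ᶠ z in 𝓝 (extChartAt I q₀ q₀), θ (R z, (extChartAt I q₀).symm z) ∈ U := by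
    have hc : ContinuousAt (fun z ↦ θ (R z, (extChartAt I q₀).symm z)) (extChartAt I q₀ q₀) :=
      hθ.continuous.continuousAt.comp
        (hRz₀.continuousAt.prodMk (continuousAt_extChartAt_symm q₀))
    refine hc.preimage_mem_nhds (hUo.mem_nhds ?_)
    show θ (R (extChartAt I q₀ q₀), (extChartAt I q₀).symm (extChartAt I q₀ q₀)) ∈ U
    rwa [hR₀, hz₀]
  have h0 : f (θ (s₀, q₀)) = 0 := (hUS _ hx₀U).1 hx₀S
  have hEq : ∀ᶠ z in 𝓝 (extChartAt I q₀ q₀), θ (R z, (extChartAt I q₀).symm z) ∈ S := by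
    filter_upwards [hW₁, hW₃] with z hzb hzU
    have h1 : f (θ (R z, (extChartAt I q₀).symm z)) = 0 := by
      have h2 := (hRg z hzb).2
      simp only [hg_def, hz₀] at h2
      exact h2.trans h0
    exact (hUS _ hzU).2 h1
  have h1 : ∀ᶠ q in 𝓝 q₀, q ∈ (extChartAt I q₀).source := extChartAt_source_mem_nhds q₀
  have h2 : ∀ᶠ q in 𝓝 q₀,
      θ (R (extChartAt I q₀ q), (extChartAt I q₀).symm (extChartAt I q₀ q)) ∈ S :=
    (continuousAt_extChartAt q₀).eventually hEq
  filter_upwards [h1, h2] with q hq hq'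
  rw [(extChartAt I q₀).left_inv hq] at hq'
  exact ⟨_, hq'⟩

end FlowSection2

/-! ### Embedded spacelike hypersurfaces are locally regular zero loci -/

section SpacelikeHypersurface

variable {E : Type*} [NormedAddCommGroup E] [NormedSpace ℝ E] [FiniteDimensional ℝ E]
  {H : Type*} [TopologicalSpace H] {I : ModelWithCorners ℝ E H} [I.Boundaryless]
  {M : Type*} [TopologicalSpace M] [ChartedSpace H M]
  {E' : Type*} [NormedAddCommGroup E'] [NormedSpace ℝ E'] [FiniteDimensional ℝ E']
  {H' : Type*} [TopologicalSpace H'] {I' : ModelWithCorners ℝ E' H'} [I'.Boundaryless]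
  {N : Type*} [TopologicalSpace N] [ChartedSpace H' N]

/-- **An embedded hypersurface is locally a regular zero locus.** Let `f : N → M` be a `C^∞`
embedding of codimension one (`dim N + 1 = dim M`). For every `y₀ ∈ N` there are an open
`U ∋ f y₀` and a function `h : M → ℝ`, `C^∞` at `f y₀`, with `f(N) ∩ U = {h = 0} ∩ U` and whose
differential at `f y₀` has kernel exactly `df_{y₀}(T_{y₀} N)`: the last coordinate of a slice
chart of the immersion (`Manifold.IsImmersionAt`: `ψ ∘ f ∘ φ⁻¹ = L ∘ (·, 0)`), on a chart domain
shrunk, using the embedding property, so that `f(N) ∩ U` is the local sheet `f(φ.source)`.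
Lee 2012, Thm. 5.8 (local slice criterion) and Prop. 5.16 (local defining functions).
[cite: LeeSmoothManifolds2013, Thm. 5.8 and Prop. 5.16] -/
theorem exists_localDefiningFunction_of_isSmoothEmbedding {f : N → M}
    (hemb : Manifold.IsSmoothEmbedding I' I ∞ f) (hdim : finrank ℝ E' + 1 = finrank ℝ E)
    (y₀ : N) (hinj : Function.Injective (mfderiv I' I f y₀)) :
    ∃ (h : M → ℝ) (U : Set M), IsOpen U ∧ f y₀ ∈ U ∧ ContMDiffAt I 𝓘(ℝ, ℝ) ∞ h (f y₀) ∧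
      (∀ q ∈ U, q ∈ range f ↔ h q = 0) ∧
      ∀ k : TangentSpace I (f y₀), mfderiv I 𝓘(ℝ, ℝ) h (f y₀) k = 0 →
        ∃ v : TangentSpace I' y₀, mfderiv I' I f y₀ v = k := by
  have him : Manifold.IsImmersionAt I' I ∞ f y₀ := hemb.isImmersion.isImmersionAt y₀
  -- slice-chart data
  set F := him.complement
  set φ := him.domChart
  set ψ := him.codChart
  set L := him.equiv
  have hy₀ : y₀ ∈ φ.source := him.mem_domChart_source
  have hx₀ : f y₀ ∈ ψ.source := him.mem_codChart_source
  have hsrc : φ.source ⊆ f ⁻¹' ψ.source := him.source_subset_preimage_source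
  have hwr : ∀ e ∈ (φ.extend I').target,
      ψ.extend I (f ((φ.extend I').symm e)) = L (e, 0) := fun e he ↦ him.writtenInCharts he
  have heφ : φ ∈ IsManifold.maximalAtlas I' ∞ N := him.domChart_mem_maximalAtlas
  have heψ : ψ ∈ IsManifold.maximalAtlas I ∞ M := him.codChart_mem_maximalAtlas
  -- the complement is a line
  haveI : FiniteDimensional ℝ (E' × F) := LinearEquiv.finiteDimensional L.symm.toLinearEquiv
  haveI : FiniteDimensional ℝ F :=
    Module.Finite.of_surjective (LinearMap.snd ℝ E' F) Prod.snd_surjective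
  have hF : finrank ℝ F = finrank ℝ ℝ := by
    have h1 : finrank ℝ (E' × F) = finrank ℝ E := LinearEquiv.finrank_eq L.toLinearEquiv
    rw [Module.finrank_prod] at h1
    rw [Module.finrank_self]
    omega
  set ℓ : F ≃L[ℝ] ℝ := ContinuousLinearEquiv.ofFinrankEq hF
  -- the defining function and the neighbourhood
  set h : M → ℝ := fun q ↦ ℓ (L.symm (ψ.extend I q)).2 with hh_def
  obtain ⟨t, hto, hft⟩ : ∃ t : Set M, IsOpen t ∧ f ⁻¹' t = φ.source :=
    hemb.isEmbedding.isInducing.isOpen_iff.1 φ.open_source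
  set U : Set M := ψ.source ∩ (fun q ↦ (L.symm (ψ.extend I q)).1) ⁻¹' (φ.extend I').target ∩ t
    with hU_def
  have hψc : ContinuousOn (fun q ↦ (L.symm (ψ.extend I q)).1) ψ.source := by
    have h1 : ContinuousOn (ψ.extend I) ψ.source := by
      rw [← ψ.extend_source (I := I)]; exact ψ.continuousOn_extend
    exact (continuous_fst.comp L.symm.continuous).comp_continuousOn h1
  have hUo : IsOpen U :=
    (hψc.isOpen_inter_preimage ψ.open_source φ.isOpen_extend_target).inter hto
  -- `ψ (f y) = L (φ y, 0)` for `y ∈ φ.source`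
  have hψf : ∀ y ∈ φ.source, ψ.extend I (f y) = L (φ.extend I' y, 0) := by
    intro y hy
    have hy' : y ∈ (φ.extend I').source := by rwa [φ.extend_source]
    have h1 := hwr _ ((φ.extend I').map_source hy')
    rwa [(φ.extend I').left_inv hy'] at h1
  have hy₀' : y₀ ∈ (φ.extend I').source := by rwa [φ.extend_source]
  have hx₀U : f y₀ ∈ U := by
    refine ⟨⟨hx₀, ?_⟩, ?_⟩
    · show (L.symm (ψ.extend I (f y₀))).1 ∈ (φ.extend I').target
      rw [hψf y₀ hy₀, L.symm_apply_apply]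
      exact (φ.extend I').map_source hy₀'
    · show y₀ ∈ f ⁻¹' t
      rw [hft]; exact hy₀
  -- smoothness of `h` at `f y₀`
  have hhs : ContMDiffAt I 𝓘(ℝ, ℝ) ∞ h (f y₀) := by
    have h1 : ContMDiffAt I 𝓘(ℝ, E) ∞ (ψ.extend I) (f y₀) :=
      (ψ.contMDiffOn_extend heψ).contMDiffAt (ψ.open_source.mem_nhds hx₀)
    have h2 : ContMDiff 𝓘(ℝ, E) 𝓘(ℝ, ℝ) ∞ (fun z : E ↦ ℓ (L.symm z).2) := by
      rw [contMDiff_iff_contDiff]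
      exact ℓ.contDiff.comp (contDiff_snd.comp L.symm.contDiff)
    exact h2.contMDiffAt.comp (f y₀) h1
  -- the zero locus
  have hzero : ∀ q ∈ U, q ∈ range f ↔ h q = 0 := by
    rintro q ⟨⟨hqψ, hq1⟩, hqt⟩
    constructor
    · rintro ⟨y, rfl⟩
      have hy : y ∈ φ.source := by rw [← hft]; exact hqt
      show ℓ (L.symm (ψ.extend I (f y))).2 = 0
      rw [hψf y hy, L.symm_apply_apply]
      exact map_zero ℓ
    · intro hq0
      have h2 : (L.symm (ψ.extend I q)).2 = 0 := ℓ.injective (by rw [map_zero]; exact hq0)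
      set e := (L.symm (ψ.extend I q)).1 with he
      have he' : e ∈ (φ.extend I').target := hq1
      refine ⟨(φ.extend I').symm e, ?_⟩
      have h3 : ψ.extend I (f ((φ.extend I').symm e)) = ψ.extend I q := by
        rw [hwr e he']
        have : (e, (0 : F)) = L.symm (ψ.extend I q) := Prod.ext rfl h2.symm
        rw [this, L.apply_symm_apply]
      have hy : (φ.extend I').symm e ∈ φ.source := by
        rw [← φ.extend_source (I := I')]; exact (φ.extend I').map_target he'
      have hfy : f ((φ.extend I').symm e) ∈ (ψ.extend I).source := by
        rw [ψ.extend_source]; exact hsrc hy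
      have hq' : q ∈ (ψ.extend I).source := by rwa [ψ.extend_source]
      exact (ψ.extend I).injOn hfy hq' h3
  -- `h ∘ f = 0` near `y₀`, so `dh ∘ df = 0`
  have hD : MDifferentiableAt I 𝓘(ℝ, ℝ) h (f y₀) := hhs.mdifferentiableAt (by simp)
  have hfd : MDifferentiableAt I' I f y₀ := (hemb.contMDiff y₀).mdifferentiableAt (by simp)
  have hcomp0 : ∀ v : TangentSpace I' y₀,
      mfderiv I 𝓘(ℝ, ℝ) h (f y₀) (mfderiv I' I f y₀ v) = 0 := by
    have hev : (h ∘ f) =ᶠ[𝓝 y₀] fun _ ↦ (0 : ℝ) := by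
      filter_upwards [φ.open_source.mem_nhds hy₀] with y hy
      show ℓ (L.symm (ψ.extend I (f y))).2 = 0
      rw [hψf y hy, L.symm_apply_apply]
      exact map_zero ℓ
    have h1 : mfderiv I' 𝓘(ℝ, ℝ) (h ∘ f) y₀ = 0 := by rw [hev.mfderiv_eq]; exact mfderiv_const
    rw [mfderiv_comp y₀ hD hfd] at h1
    intro v
    have := congrArg (fun T ↦ T v) h1
    exact this
  -- a curve along the complement direction on which `h` is the parameter: `dh ≠ 0`
  obtain ⟨v₀, hv₀⟩ : ∃ v₀ : TangentSpace I (f y₀), mfderiv I 𝓘(ℝ, ℝ) h (f y₀) v₀ = 1 := by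
    set e₀ := φ.extend I' y₀ with he₀
    set w : F := ℓ.symm 1 with hw
    set c : ℝ → M := fun s ↦ (ψ.extend I).symm (L (e₀, s • w)) with hc_def
    have hψ0 : ψ.extend I (f y₀) = L (e₀, 0) := hψf y₀ hy₀
    have htgt : L (e₀, 0) ∈ (ψ.extend I).target := by
      rw [← hψ0]; exact (ψ.extend I).map_source (by rwa [ψ.extend_source])
    have hc0 : c 0 = f y₀ := by
      simp only [hc_def, zero_smul]
      rw [← hψ0]
      exact (ψ.extend I).left_inv (by rwa [ψ.extend_source])
    -- `c` is smooth at `0`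
    have hline : ContMDiff 𝓘(ℝ, ℝ) 𝓘(ℝ, E) ∞ (fun s : ℝ ↦ L (e₀, s • w)) := by
      rw [contMDiff_iff_contDiff]
      exact L.contDiff.comp (contDiff_const.prodMk (contDiff_id.smul contDiff_const))
    have hcs : ContMDiffAt 𝓘(ℝ, ℝ) I ∞ c 0 := by
      have h1 : ContMDiffAt 𝓘(ℝ, E) I ∞ (ψ.extend I).symm (L (e₀, (0 : ℝ) • w)) := by
        rw [zero_smul]
        refine (contMDiffOn_extend_symm heψ).contMDiffAt ?_
        rw [← ψ.extend_target' (I := I)]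
        exact ψ.isOpen_extend_target.mem_nhds htgt
      exact h1.comp 0 hline.contMDiffAt
    -- `h ∘ c = id` near `0`
    have hev : ∀ᶠ s in 𝓝 (0 : ℝ), h (c s) = s := by
      have hct : ∀ᶠ s in 𝓝 (0 : ℝ), L (e₀, s • w) ∈ (ψ.extend I).target := by
        refine hline.continuous.continuousAt.preimage_mem_nhds ?_
        refine ψ.isOpen_extend_target.mem_nhds ?_
        show L (e₀, (0 : ℝ) • w) ∈ (ψ.extend I).target
        rwa [zero_smul]
      filter_upwards [hct] with s hs
      show ℓ (L.symm (ψ.extend I ((ψ.extend I).symm (L (e₀, s • w))))).2 = s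
      rw [(ψ.extend I).right_inv hs, L.symm_apply_apply]
      show ℓ (s • w) = s
      rw [map_smul, hw, ℓ.apply_symm_apply, smul_eq_mul, mul_one]
    have hd1 : HasDerivAt (fun s ↦ h (c s)) 1 0 :=
      (hasDerivAt_id (0 : ℝ)).congr_of_eventuallyEq hev
    have hD' : MDifferentiableAt I 𝓘(ℝ, ℝ) h (c 0) := by rw [hc0]; exact hD
    have hd2 : HasDerivAt (fun s ↦ h (c s)) (mfderiv I 𝓘(ℝ, ℝ) h (c 0) (velocity I c 0)) 0 :=
      hasDerivAt_comp_curve hD' (hcs.mdifferentiableAt (by simp))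
    have heq := hd2.unique hd1
    refine ⟨hc0 ▸ velocity I c 0, ?_⟩
    have key : ∀ {p : M} (hp : p = f y₀) (v : TangentSpace I p),
        mfderiv I 𝓘(ℝ, ℝ) h (f y₀) (hp ▸ v) = mfderiv I 𝓘(ℝ, ℝ) h p v := by
      rintro p rfl v; rfl
    rw [key hc0]
    exact heq
  -- dimension count: `range df ⊕ ℝ v₀ = T_{f y₀} M`, and `dh` vanishes on `range df`
  haveI : FiniteDimensional ℝ (TangentSpace I (f y₀)) := inferInstanceAs (FiniteDimensional ℝ E)
  haveI : FiniteDimensional ℝ (TangentSpace I' y₀) := inferInstanceAs (FiniteDimensional ℝ E')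
  set A : TangentSpace I' y₀ →ₗ[ℝ] TangentSpace I (f y₀) := (mfderiv I' I f y₀).toLinearMap
    with hAdef
  have hAinj : Function.Injective A := hinj
  have hv₀ne : v₀ ≠ 0 := by
    intro h0
    rw [h0, map_zero] at hv₀
    have hv₀' : (0 : ℝ) = 1 := hv₀
    exact zero_ne_one hv₀'
  have hv₀nm : v₀ ∉ LinearMap.range A := by
    rintro ⟨v, hv⟩
    have h1 := hcomp0 v
    have h2 : A v = mfderiv I' I f y₀ v := rfl
    rw [← h2, hv, hv₀] at h1
    have h1' : (1 : ℝ) = 0 := h1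
    exact one_ne_zero h1'
  have hdisj : Disjoint (LinearMap.range A) (ℝ ∙ v₀) :=
    (Submodule.disjoint_span_singleton' hv₀ne).2 hv₀nm
  have hrange : finrank ℝ (LinearMap.range A) = finrank ℝ E' :=
    (LinearMap.finrank_range_of_inj hAinj).trans rfl
  have hsup : LinearMap.range A ⊔ (ℝ ∙ v₀) = ⊤ := by
    apply Submodule.eq_top_of_finrank_eq
    have h1 := Submodule.finrank_sup_add_finrank_inf_eq (LinearMap.range A) (ℝ ∙ v₀)
    rw [hdisj.eq_bot, finrank_bot, hrange, finrank_span_singleton hv₀ne, add_zero] at h1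
    rw [h1]
    exact hdim
  refine ⟨h, U, hUo, hx₀U, hhs, hzero, fun k hk ↦ ?_⟩
  have hk' : k ∈ LinearMap.range A ⊔ (ℝ ∙ v₀) := by rw [hsup]; exact Submodule.mem_top
  obtain ⟨y, hy, z, hz, hyz⟩ := Submodule.mem_sup.1 hk'
  obtain ⟨c, rfl⟩ := Submodule.mem_span_singleton.1 hz
  obtain ⟨v, rfl⟩ := hy
  have h1 : mfderiv I 𝓘(ℝ, ℝ) h (f y₀) (A v + c • v₀) = 0 := by rw [hyz]; exact hk
  rw [map_add, map_smul, hv₀] at h1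
  have h2 : mfderiv I 𝓘(ℝ, ℝ) h (f y₀) (A v) = 0 := hcomp0 v
  rw [h2, zero_add] at h1
  have hc : c = 0 := by
    have h1' : c • (1 : ℝ) = 0 := h1
    simpa using h1'
  refine ⟨v, ?_⟩
  rw [← hyz, hc, zero_smul, add_zero]
  rfl

/-- **A smooth spacelike embedded hypersurface is locally a spacelike regular zero locus.** For a
spacelike immersion `f : N → M` of codimension one which is a `C^∞` embedding and `y₀ ∈ N` there
are an open `U ∋ f y₀` and `h : M → ℝ`, `C^∞` at `f y₀`, with `f(N) ∩ U = {h = 0} ∩ U` and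
`dh_{f y₀}(k) ≠ 0` for every non-zero `k` with `g(k, k) ≤ 0` (the kernel of `dh` is the spacelike
tangent space `df(T_{y₀} N)`, `exists_localDefiningFunction_of_isSmoothEmbedding`); in a
Lorentzian manifold: for every non-zero causal `k`, in particular `dh(K) ≠ 0` for every timelike
`K`. O'Neill 1983, Ch. 5, p. 142 (spacelike
submanifolds) with Lee 2012, Prop. 5.16. [cite: ONeillSemiRiemannian1983, Ch. 5, p. 142]
[cite: LeeSmoothManifolds2013, Prop. 5.16] -/
theorem PseudoRiemannianMetric.IsSpacelikeImmersion.exists_localDefiningFunction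
    [IsManifold I ∞ M] {n : ℕ∞ω} {g : PseudoRiemannianMetric I n E (TangentSpace I : M → Type _)}
    {f : N → M} (hf : g.IsSpacelikeImmersion I' f) (hemb : Manifold.IsSmoothEmbedding I' I ∞ f)
    (hdim : finrank ℝ E' + 1 = finrank ℝ E) (y₀ : N) :
    ∃ (h : M → ℝ) (U : Set M), IsOpen U ∧ f y₀ ∈ U ∧ ContMDiffAt I 𝓘(ℝ, ℝ) ∞ h (f y₀) ∧
      (∀ q ∈ U, q ∈ range f ↔ h q = 0) ∧
      ∀ k : TangentSpace I (f y₀), k ≠ 0 → g.val (f y₀) k k ≤ 0 →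
        mfderiv I 𝓘(ℝ, ℝ) h (f y₀) k ≠ 0 := by
  obtain ⟨h, U, hUo, hx₀U, hhs, hzero, hker⟩ :=
    exists_localDefiningFunction_of_isSmoothEmbedding hemb hdim y₀ (hf.injective_mfderiv y₀)
  refine ⟨h, U, hUo, hx₀U, hhs, hzero, fun k hk0 hkc hk ↦ ?_⟩
  obtain ⟨v, rfl⟩ := hker k hk
  have hv : v ≠ 0 := by
    rintro rfl
    exact hk0 (map_zero _)
  have hpos := hf.inducedBilin_pos y₀ hv
  rw [inducedBilin_apply] at hpos
  exact absurd hkc (not_le.2 hpos)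

end SpacelikeHypersurface

/-! ### The stationary flow of a black hole: spacelike sections give spacelike time functions -/

namespace StationaryAFBlackHole

variable (𝓑 : StationaryAFBlackHole.{u}) [𝓑.metric.HasLeviCivita]

/-- **A smooth spacelike section of the stationary flow on `⟨⟨M_ext⟩⟩` yields the time function of
Chruściel–Costa's structure theorem** (Thm. 4.5, the last paragraph of its proof, for the
space-time of a `StationaryAFBlackHole`).  Let `θ` be the flow of the stationary Killing field
`K = X₀` (smooth, group law, by isometries — `exists_stationary_flow`) and `S` a subset of
space-time which near each of its points `x` is the zero set of a function `f`, smooth at `x`,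
with `df_x(K) ≠ 0` (transversality) and `df_x(k) ≠ 0` for every non-zero causal `k` (a smooth
**spacelike** hypersurface), and which is met **exactly once** by the orbit of every point of
`⟨⟨M_ext⟩⟩ = 𝓑.doc`.  Then `t (p) := -`(the parameter `s` with `θ (s, p) ∈ S`) ("the unique value of
parameter `t` so that `φ_t(p) ∈ 𝒮₀`") is `C^∞` on `⟨⟨M_ext⟩⟩` (`contMDiffAt_crossParam_infty`),
satisfies `t (γ s) = t (γ 0) + s` along every Killing orbit from `⟨⟨M_ext⟩⟩` (`crossParam_flow`;
integral curves are flow lines, `eq_flow_of_isMIntegralCurve`, and `⟨⟨M_ext⟩⟩` is flow invariant,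
`mem_doc_of_isMIntegralCurve`), and `dt_x(k) ≠ 0` for all `x ∈ ⟨⟨M_ext⟩⟩` and non-zero causal `k`
(`mfderiv_crossParam_ne_zero`: the flow maps are isometries, `g(dθ_s k, dθ_s k) = g(k, k)`, with
injective differential, `mfderiv_flow_ne_zero`) — the three clauses of
`chruscielCosta2008_spacelikeTimeFunction`. Chruściel–Costa 2008, §4.2, proof of Thm. 4.5, last
paragraph. [cite: ChruscielCosta2008, Thm. 4.5 (proof, last paragraph)] -/
theorem exists_spacelikeTimeFunction_of_section
    {θ : ℝ × 𝓑.carrier → 𝓑.carrier} (hθ : ContMDiff (𝓘(ℝ, ℝ).prod (𝓡 4)) (𝓡 4) ∞ θ)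
    (hθ0 : ∀ p, θ (0, p) = p) (hθadd : ∀ t s p, θ (t, θ (s, p)) = θ (t + s, p))
    (hθX : ∀ p, IsMIntegralCurve (fun t ↦ θ (t, p)) 𝓑.killing)
    (hiso : ∀ (t : ℝ) (p : 𝓑.carrier) (v w : TangentSpace (𝓡 4) p),
      𝓑.metric.val (θ (t, p)) (mfderiv (𝓡 4) (𝓡 4) (fun q ↦ θ (t, q)) p v)
        (mfderiv (𝓡 4) (𝓡 4) (fun q ↦ θ (t, q)) p w) = 𝓑.metric.val p v w)
    {S : Set 𝓑.carrier}
    (hloc : ∀ x ∈ S, ∃ (f : 𝓑.carrier → ℝ) (U : Set 𝓑.carrier), IsOpen U ∧ x ∈ U ∧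
      ContMDiffAt (𝓡 4) 𝓘(ℝ, ℝ) ∞ f x ∧ (∀ y ∈ U, y ∈ S ↔ f y = 0) ∧
      mfderiv (𝓡 4) 𝓘(ℝ, ℝ) f x (𝓑.killing x) ≠ 0 ∧
      ∀ k : TangentSpace (𝓡 4) x, 𝓑.metric.val x k k ≤ 0 → k ≠ 0 →
        mfderiv (𝓡 4) 𝓘(ℝ, ℝ) f x k ≠ 0)
    (honce : ∀ p ∈ 𝓑.doc, ∃! s : ℝ, θ (s, p) ∈ S) :
    ∃ t : 𝓑.carrier → ℝ,
      ContMDiffOn (𝓡 4) 𝓘(ℝ, ℝ) ((⊤ : ℕ∞) : WithTop ℕ∞) t 𝓑.doc ∧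
      (∀ γ : ℝ → 𝓑.carrier, IsMIntegralCurve γ 𝓑.killing → γ 0 ∈ 𝓑.doc →
        ∀ s : ℝ, t (γ s) = t (γ 0) + s) ∧
      ∀ x ∈ 𝓑.doc, ∀ k : TangentSpace (𝓡 4) x, 𝓑.metric.val x k k ≤ 0 → k ≠ 0 →
        mvfderiv (𝓡 4) t x k ≠ 0 := by
  -- the crossing parameter `σ` of the section
  have key : ∀ p, ∃ s : ℝ, p ∈ 𝓑.doc → θ (s, p) ∈ S ∧ ∀ s', θ (s', p) ∈ S → s' = s := by
    intro p
    by_cases hp : p ∈ 𝓑.doc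
    · obtain ⟨s, hs, hu⟩ := honce p hp
      exact ⟨s, fun _ ↦ ⟨hs, hu⟩⟩
    · exact ⟨0, fun h ↦ (hp h).elim⟩
  choose σ hσ' using key
  have hσ : ∀ p ∈ 𝓑.doc, θ (σ p, p) ∈ S := fun p hp ↦ (hσ' p hp).1
  have huniq : ∀ p ∈ 𝓑.doc, ∀ s : ℝ, θ (s, p) ∈ S → s = σ p :=
    fun p hp s hs ↦ (hσ' p hp).2 s hs
  have hD : IsOpen 𝓑.doc :=
    𝓑.isOpen_doc LorentzianMetric.isOpen_chronologicalFuture_holds_of_boundaryless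
      LorentzianMetric.isOpen_chronologicalPast_holds_of_boundaryless
  have hDinv : ∀ (s : ℝ) (p : 𝓑.carrier), p ∈ 𝓑.doc → θ (s, p) ∈ 𝓑.doc := by
    intro s p hp
    have h0 : (fun t ↦ θ (t, p)) 0 ∈ 𝓑.doc := by simpa only [hθ0] using hp
    exact mem_doc_of_isMIntegralCurve (hθX p) h0 s
  -- the cone of non-zero causal vectors is invariant under the (isometric) flow maps
  have hθ2 : ContMDiff (𝓘(ℝ, ℝ).prod (𝓡 4)) (𝓡 4) 2 θ := hθ.of_le (WithTop.coe_le_coe.mpr le_top)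
  have hC : ∀ (s : ℝ) (p : 𝓑.carrier) (k : TangentSpace (𝓡 4) p),
      (𝓑.metric.val p k k ≤ 0 ∧ k ≠ 0) →
      (𝓑.metric.val (θ (s, p)) (mfderiv (𝓡 4) (𝓡 4) (fun q ↦ θ (s, q)) p k)
          (mfderiv (𝓡 4) (𝓡 4) (fun q ↦ θ (s, q)) p k) ≤ 0 ∧
        mfderiv (𝓡 4) (𝓡 4) (fun q ↦ θ (s, q)) p k ≠ 0) := by
    rintro s p k ⟨hk, hk0⟩
    refine ⟨by rw [hiso]; exact hk, ?_⟩
    exact PseudoRiemannianMetric.mfderiv_flow_ne_zero hθ2 hθ0 hθadd s hk0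
  have hloc' : ∀ x ∈ S, ∃ (f : 𝓑.carrier → ℝ) (U : Set 𝓑.carrier), IsOpen U ∧ x ∈ U ∧
      ContMDiffAt (𝓡 4) 𝓘(ℝ, ℝ) ∞ f x ∧ (∀ y ∈ U, y ∈ S ↔ f y = 0) ∧
      mfderiv (𝓡 4) 𝓘(ℝ, ℝ) f x (𝓑.killing x) ≠ 0 ∧
      ∀ k : TangentSpace (𝓡 4) x, (𝓑.metric.val x k k ≤ 0 ∧ k ≠ 0) →
        mfderiv (𝓡 4) 𝓘(ℝ, ℝ) f x k ≠ 0 := by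
    intro x hx
    obtain ⟨f, U, hU, hxU, hf, hUS, hfX, hfC⟩ := hloc x hx
    exact ⟨f, U, hU, hxU, hf, hUS, hfX, fun k hk ↦ hfC k hk.1 hk.2⟩
  have hsmooth : ∀ p ∈ 𝓑.doc, ContMDiffAt (𝓡 4) 𝓘(ℝ, ℝ) ∞ σ p := fun p hp ↦
    contMDiffAt_crossParam_infty hθ hθX hD hσ huniq hloc' hp
  refine ⟨-σ, fun p hp ↦ (hsmooth p hp).neg.contMDiffWithinAt, ?_, ?_⟩
  · -- equivariance along the Killing orbits
    intro γ hγ h0 s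
    have hK1 : ContMDiff (𝓡 4) (𝓡 4).tangent 1
        (fun x ↦ (⟨x, 𝓑.killing x⟩ : TangentBundle (𝓡 4) 𝓑.carrier)) :=
      𝓑.isStationaryKilling.isKillingField.contMDiff.of_le (WithTop.coe_le_coe.mpr le_top)
    rw [eq_flow_of_isMIntegralCurve hK1 hθX hθ0 hγ s]
    show -σ (θ (s, γ 0)) = -σ (γ 0) + s
    rw [crossParam_flow hθadd hDinv hσ huniq h0 s]
    ring
  · -- the level sets are spacelike
    intro x hx k hk hk0 h0
    have h := mfderiv_crossParam_ne_zero hθ hθX hD hσ huniq hloc' hC hx ⟨hk, hk0⟩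
    have h1 : mfderiv (𝓡 4) 𝓘(ℝ, ℝ) (-σ) x k = 0 := h0
    rw [mfderiv_neg] at h1
    exact h (neg_eq_zero.1 h1)

/-- **Chruściel–Costa's Thm. 4.5 (time function with spacelike level sets) in the strictly
stationary case.**  Let `𝓑` be a stationary asymptotically flat black hole whose stationary
Killing field `K` is timelike on the whole domain of outer communications (no ergoregion — e.g. a
static `I⁺`-regular black hole after the Vishveshwara–Carter lemma), `S` the hypersurface of
Def. 1.1 (`IPlusRegularHypersurface`: a `C^∞`-embedded spacelike acausal hypersurface in
`⟨⟨M_ext⟩⟩`), and grant the partition `⟨⟨M_ext⟩⟩ ⊆ I⁺(S) ∪ S ∪ I⁻(S)` of the printed proof (hypothesis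
`hpart`, as in `DocOrbitsMeetHypersurface.lean`).  Then `S` itself is a spacelike section of the
stationary flow on `⟨⟨M_ext⟩⟩`: locally a spacelike regular zero locus
(`IsSpacelikeImmersion.exists_localDefiningFunction`), transverse to the timelike `K`, met by every
orbit (`IPlusRegularHypersurface.exists_apply_mem_carrierSet`) and at most once (an orbit segment
between two points of `S` would be a future timelike curve,
`apply_mem_chronologicalFuture_of_isMIntegralCurve`, against the achronality of `S`); so
`exists_spacelikeTimeFunction_of_section` gives a function `t`, `C^∞` on `⟨⟨M_ext⟩⟩`, with
`t (γ s) = t (γ 0) + s` along the Killing orbits from `⟨⟨M_ext⟩⟩` and `dt_x(k) ≠ 0` for non-zero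
causal `k` — the conclusion of `chruscielCosta2008_spacelikeTimeFunction` for `𝓑`. Chruściel–Costa
2008, §4.2, Thm. 4.5 (here without ergoregion, where Prop. 4.6 and the smoothing of §4.2 are not
needed: "the desired hypersurface … coincides with `S`"). [cite: ChruscielCosta2008, Thm. 4.5 (proof, §4.2)] -/
theorem IPlusRegularHypersurface.exists_spacelikeTimeFunction_of_isTimelike
    {𝓑 : StationaryAFBlackHole.{u}} [𝓑.metric.HasLeviCivita] (𝒮 : 𝓑.IPlusRegularHypersurface)
    (hT : ∀ p ∈ 𝓑.doc, 𝓑.metric.IsTimelike (𝓑.killing p))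
    (hpart : 𝓑.doc ⊆ 𝓑.metric.chronologicalFuture 𝓑.timeOrientation 𝒮.carrierSet ∪ 𝒮.carrierSet ∪
      𝓑.metric.chronologicalPast 𝓑.timeOrientation 𝒮.carrierSet) :
    ∃ t : 𝓑.carrier → ℝ,
      ContMDiffOn (𝓡 4) 𝓘(ℝ, ℝ) ((⊤ : ℕ∞) : WithTop ℕ∞) t 𝓑.doc ∧
      (∀ γ : ℝ → 𝓑.carrier, IsMIntegralCurve γ 𝓑.killing → γ 0 ∈ 𝓑.doc →
        ∀ s : ℝ, t (γ s) = t (γ 0) + s) ∧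
      ∀ x ∈ 𝓑.doc, ∀ k : TangentSpace (𝓡 4) x, 𝓑.metric.val x k k ≤ 0 → k ≠ 0 →
        mvfderiv (𝓡 4) t x k ≠ 0 := by
  obtain ⟨θ, hθ, hθ0, hθadd, hθX, hiso, -⟩ := 𝓑.exists_stationary_flow
  have hdim : finrank ℝ E3 + 1 = finrank ℝ E4 := by simp
  refine 𝓑.exists_spacelikeTimeFunction_of_section hθ hθ0 hθadd hθX hiso (S := 𝒮.carrierSet)
    ?_ ?_
  · -- `S` is locally a spacelike regular zero locus, transverse to the timelike `K`
    rintro _ ⟨y₀, rfl⟩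
    obtain ⟨h, U, hUo, hx₀U, hhs, hzero, hker⟩ :=
      𝒮.isSpacelike.exists_localDefiningFunction 𝒮.isSmoothEmbedding hdim y₀
    have hKt : 𝓑.metric.IsTimelike (𝓑.killing (𝒮.f y₀)) :=
      hT _ (𝒮.carrierSet_subset_doc ⟨y₀, rfl⟩)
    exact ⟨h, U, hUo, hx₀U, hhs, hzero, hker _ hKt.ne_zero hKt.le,
      fun k hkc hk0 ↦ hker k hk0 hkc⟩
  · -- every orbit through `⟨⟨M_ext⟩⟩` meets `S` exactly once
    intro p hp
    have hdoc : ∀ u, θ (u, p) ∈ 𝓑.doc := fun u ↦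
      mem_doc_of_isMIntegralCurve (hθX p) (by simpa only [hθ0] using hp) u
    have hfut : ∀ u, 𝓑.metric.IsTimelike (𝓑.killing (θ (u, p))) ∧
        𝓑.timeOrientation.IsFutureDirected (𝓑.killing (θ (u, p))) := fun u ↦
      ⟨hT _ (hdoc u), isFutureDirected_killing_of_forall_isTimelike hT (hdoc u)⟩
    obtain ⟨s, hs⟩ := 𝒮.exists_apply_mem_carrierSet hpart hp (hθX p) (hθ0 p)
    refine ⟨s, hs, fun s' hs' ↦ ?_⟩
    by_contra hne
    rcases lt_or_gt_of_ne hne with hlt | hlt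
    · exact 𝒮.isAchronal _ hs' _ hs
        (LorentzianMetric.apply_mem_chronologicalFuture_of_isMIntegralCurve (hθX p) hlt
          fun u _ ↦ hfut u)
    · exact 𝒮.isAchronal _ hs _ hs'
        (LorentzianMetric.apply_mem_chronologicalFuture_of_isMIntegralCurve (hθX p) hlt
          fun u _ ↦ hfut u)

end StationaryAFBlackHole

/-! ### The strictly stationary case without the partition hypothesis -/

namespace StationaryAFBlackHole.IPlusRegularHypersurface

variable {𝓑 : StationaryAFBlackHole.{u}}

/-- **`S̄ ∩ ⟨⟨M_ext⟩⟩ = S`: the hypersurface of Def. 1.1 is closed in the d.o.c.** (`∂S̄ ⊆ 𝓔⁺`,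
(1.1), and `𝓔⁺ ∩ ⟨⟨M_ext⟩⟩ = ∅`). Chruściel–Costa 2008, Def. 1.1 and §2.2. [cite: ChruscielCosta2008, Def. 1.1 (1.1)] -/
theorem closure_carrierSet_inter_doc_subset (𝒮 : 𝓑.IPlusRegularHypersurface) :
    closure 𝒮.carrierSet ∩ 𝓑.doc ⊆ 𝒮.carrierSet := by
  rintro x ⟨hxc, hxd⟩
  by_contra hxS
  have hxH : x ∈ 𝓑.horizon := 𝒮.boundarySet_subset_horizon ⟨hxc, hxS⟩
  exact Set.disjoint_left.1
    (𝓑.disjoint_horizon_doc LorentzianMetric.isOpen_chronologicalPast_holds_of_boundaryless) hxH hxd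

/-- **Every Killing orbit through `⟨⟨M_ext⟩⟩` meets the hypersurface `S` of Def. 1.1 — without the
partition hypothesis, when the stationary Killing field is timelike on `⟨⟨M_ext⟩⟩`.**  For the
stationary flow `θ` and `A := {q | ∃ s, θ (s, q) ∈ S}` (the flow saturation `⋃ₜ φₜ(S)` of `S`):
`A` is open (the orbits are transverse to the spacelike `S` where `K` is timelike:
`eventually_exists_flow_mem` with `IsSpacelikeImmersion.exists_localDefiningFunction`); `A` meets
the connected `⟨⟨M_ext⟩⟩` (`S ≠ ∅`, `isConnected_doc`); and `closure A ∩ ⟨⟨M_ext⟩⟩ ⊆ A`: near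
`p ∈ ⟨⟨M_ext⟩⟩` the crossing parameters of the orbits through `A` are bounded — if
`θ (s, q), θ (s₀, a₀) ∈ S` with `q, a₀ ∈ I⁺(φ₋₁ p) ∩ I⁻(φ₁ p)` and `s > s₀ + 2`, then
`θ (s₀, a₀) ≪ φ_{s₀+1} p ≪ φ_{s-1} p ≪ θ (s, q)` (the flow maps preserve `≪`,
`IsKillingField.image_flow_chronologicalFuture`; the orbit of `p` is a future timelike curve)
contradicts the achronality of `S` — so a limit of points of `A` has a crossing parameter in a
compact interval, hence (projection along a compact factor is closed) its orbit meets `S̄`, inside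
`⟨⟨M_ext⟩⟩`, i.e. `S` (`closure_carrierSet_inter_doc_subset`). Connectedness gives `⟨⟨M_ext⟩⟩ ⊆ A`.
This replaces, in the strictly stationary case, the partition step of the printed proof
(Chruściel–Costa 2008, §4.2: "`⟨⟨M_ext⟩⟩ = I⁺(S) ∪ S ∪ I⁻(S)` … every orbit of `K₀` intersects `S`").
[cite: ChruscielCosta2008, §4.2 (proof of Thm. 4.5, (4.13))] -/
theorem exists_flow_mem_carrierSet_of_isTimelike [𝓑.metric.HasLeviCivita]
    (𝒮 : 𝓑.IPlusRegularHypersurface) (hT : ∀ p ∈ 𝓑.doc, 𝓑.metric.IsTimelike (𝓑.killing p))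
    {θ : ℝ × 𝓑.carrier → 𝓑.carrier} (hθ : ContMDiff (𝓘(ℝ, ℝ).prod (𝓡 4)) (𝓡 4) ∞ θ)
    (hθ0 : ∀ p, θ (0, p) = p) (hθadd : ∀ t s p, θ (t, θ (s, p)) = θ (t + s, p))
    (hθX : ∀ p, IsMIntegralCurve (fun t ↦ θ (t, p)) 𝓑.killing) {p : 𝓑.carrier} (hp : p ∈ 𝓑.doc) :
    ∃ s : ℝ, θ (s, p) ∈ 𝒮.carrierSet := by
  set S := 𝒮.carrierSet with hS_def
  set A : Set 𝓑.carrier := {q | ∃ s : ℝ, θ (s, q) ∈ S} with hA_def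
  have hdim : finrank ℝ E3 + 1 = finrank ℝ E4 := by simp
  have hθ2 : ContMDiff (𝓘(ℝ, ℝ).prod (𝓡 4)) (𝓡 4) 2 θ := hθ.of_le (WithTop.coe_le_coe.mpr le_top)
  have hK : 𝓑.metric.IsKillingField 𝓑.killing := 𝓑.isStationaryKilling.isKillingField
  have hDinv : ∀ (s : ℝ) (q : 𝓑.carrier), q ∈ 𝓑.doc → θ (s, q) ∈ 𝓑.doc := by
    intro s q hq
    have h0 : (fun t ↦ θ (t, q)) 0 ∈ 𝓑.doc := by simpa only [hθ0] using hq
    exact mem_doc_of_isMIntegralCurve (hθX q) h0 s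
  -- `≪` along orbits in the d.o.c. and under the flow maps
  have hll : ∀ q ∈ 𝓑.doc, ∀ a b : ℝ, a < b →
      θ (b, q) ∈ 𝓑.metric.chronologicalFuture 𝓑.timeOrientation {θ (a, q)} := by
    intro q hq a b hab
    exact LorentzianMetric.apply_mem_chronologicalFuture_of_isMIntegralCurve (hθX q) hab
      fun u _ ↦ ⟨hT _ (hDinv u q hq), isFutureDirected_killing_of_forall_isTimelike hT (hDinv u q hq)⟩
  have hflow : ∀ (t : ℝ) {q r : 𝓑.carrier},
      r ∈ 𝓑.metric.chronologicalFuture 𝓑.timeOrientation {q} →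
      θ (t, r) ∈ 𝓑.metric.chronologicalFuture 𝓑.timeOrientation {θ (t, q)} := by
    intro t q r hr
    have h := hK.image_flow_chronologicalFuture (τ := 𝓑.timeOrientation) hθ2 hθ0 hθadd hθX t {q}
    rw [Set.image_singleton] at h
    rw [← h]
    exact Set.mem_image_of_mem _ hr
  -- (1) `A` is open
  have hAo : IsOpen A := by
    rw [isOpen_iff_mem_nhds]
    rintro q₀ ⟨s₀, hs₀⟩
    obtain ⟨y₀, hy₀⟩ := Set.mem_range.1 hs₀
    obtain ⟨h, U, hUo, hx₀U, hhs, hzero, hker⟩ :=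
      𝒮.isSpacelike.exists_localDefiningFunction 𝒮.isSmoothEmbedding hdim y₀
    rw [hy₀] at hx₀U hhs hker
    have hKt : 𝓑.metric.IsTimelike (𝓑.killing (θ (s₀, q₀))) :=
      hT _ (𝒮.carrierSet_subset_doc hs₀)
    have hzero' : ∀ y ∈ U, y ∈ S ↔ h y = 0 := fun y hy ↦ hzero y hy
    exact eventually_exists_flow_mem hθ hθX hUo hx₀U hs₀ hhs hzero'
      (hker _ hKt.ne_zero hKt.le)
  -- (2) `A` meets the d.o.c.
  have hne : (𝓑.doc ∩ A).Nonempty := by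
    obtain ⟨x, hx⟩ := 𝒮.isConnected.nonempty
    exact ⟨x, 𝒮.carrierSet_subset_doc hx, 0, by rw [hθ0]; exact hx⟩
  -- (3) `closure A ∩ doc ⊆ A`
  have hcl : closure A ∩ 𝓑.doc ⊆ A := by
    rintro p ⟨hpA, hp⟩
    -- the neighbourhood `V = I⁺(φ₋₁ p) ∩ I⁻(φ₁ p)` of `p`
    set U₀ := 𝓑.metric.chronologicalFuture 𝓑.timeOrientation {θ (-1, p)} with hU₀
    set U₁ := 𝓑.metric.chronologicalPast 𝓑.timeOrientation {θ (1, p)} with hU₁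
    have hpU₀ : p ∈ U₀ := by
      have := hll p hp (-1) 0 (by norm_num)
      rwa [hθ0] at this
    have hpU₁ : p ∈ U₁ := by
      have := hll p hp 0 1 (by norm_num)
      rw [hθ0] at this
      exact LorentzianMetric.mem_chronologicalPast_of_mem_chronologicalFuture this
    have hVo : IsOpen (U₀ ∩ U₁) :=
      (LorentzianMetric.isOpen_chronologicalFuture_of_boundaryless _ _ _).inter
        (LorentzianMetric.isOpen_chronologicalPast_of_boundaryless _ _ _)
    -- a reference point of `A` in `V`
    obtain ⟨a₀, ⟨ha₀U₀, ha₀U₁⟩, s₀, hs₀⟩ : ((U₀ ∩ U₁) ∩ A).Nonempty :=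
      mem_closure_iff.1 hpA _ hVo ⟨hpU₀, hpU₁⟩
    -- crossing parameters over `V` are within `2` of `s₀`
    have hkey : ∀ q ∈ U₀ ∩ U₁, ∀ s : ℝ, θ (s, q) ∈ S → s ≤ s₀ + 2 ∧ s₀ - 2 ≤ s := by
      rintro q ⟨hqU₀, hqU₁⟩ s hs
      constructor
      · by_contra hlt
        rw [not_le] at hlt
        -- `θ (s₀, a₀) ≪ φ_{s₀+1} p ≪ φ_{s-1} p ≪ θ (s, q)`
        have h1 : θ (s₀ + 1, p) ∈ 𝓑.metric.chronologicalFuture 𝓑.timeOrientation {θ (s₀, a₀)} := by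
          have := hflow s₀ (LorentzianMetric.mem_chronologicalFuture_of_mem_chronologicalPast ha₀U₁)
          rwa [hθadd] at this
        have h2 : θ (s - 1, p) ∈ 𝓑.metric.chronologicalFuture 𝓑.timeOrientation {θ (s₀ + 1, p)} :=
          hll p hp _ _ (by linarith)
        have h3 : θ (s, q) ∈ 𝓑.metric.chronologicalFuture 𝓑.timeOrientation {θ (s - 1, p)} := by
          have := hflow s hqU₀
          rwa [hθadd, show s + -1 = s - 1 by ring] at this
        exact 𝒮.isAchronal _ hs₀ _ hs
          (LorentzianMetric.mem_chronologicalFuture_trans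
            (LorentzianMetric.mem_chronologicalFuture_trans h1 h2) h3)
      · by_contra hlt
        rw [not_le] at hlt
        -- `θ (s, q) ≪ φ_{s+1} p ≪ φ_{s₀-1} p ≪ θ (s₀, a₀)`
        have h1 : θ (s + 1, p) ∈ 𝓑.metric.chronologicalFuture 𝓑.timeOrientation {θ (s, q)} := by
          have := hflow s (LorentzianMetric.mem_chronologicalFuture_of_mem_chronologicalPast hqU₁)
          rwa [hθadd] at this
        have h2 : θ (s₀ - 1, p) ∈ 𝓑.metric.chronologicalFuture 𝓑.timeOrientation {θ (s + 1, p)} :=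
          hll p hp _ _ (by linarith)
        have h3 : θ (s₀, a₀) ∈ 𝓑.metric.chronologicalFuture 𝓑.timeOrientation {θ (s₀ - 1, p)} := by
          have := hflow s₀ ha₀U₀
          rwa [hθadd, show s₀ + -1 = s₀ - 1 by ring] at this
        exact 𝒮.isAchronal _ hs _ hs₀
          (LorentzianMetric.mem_chronologicalFuture_trans
            (LorentzianMetric.mem_chronologicalFuture_trans h1 h2) h3)
    -- the set of points whose orbit meets `S̄` at a parameter in `[s₀ - 2, s₀ + 2]` is closed
    set C : Set 𝓑.carrier := {q | ∃ s ∈ Set.Icc (s₀ - 2) (s₀ + 2), θ (s, q) ∈ closure S} with hC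
    have hCc : IsClosed C := by
      have hF : IsClosed {z : Set.Icc (s₀ - 2) (s₀ + 2) × 𝓑.carrier | θ ((z.1 : ℝ), z.2) ∈ closure S} :=
        isClosed_closure.preimage
          (hθ.continuous.comp (continuous_subtype_val.fst'.prodMk continuous_snd))
      have hCeq : C = Prod.snd '' {z : Set.Icc (s₀ - 2) (s₀ + 2) × 𝓑.carrier |
          θ ((z.1 : ℝ), z.2) ∈ closure S} := by
        ext q
        simp only [hC, Set.mem_setOf_eq, Set.mem_image, Prod.exists, Subtype.exists,
          exists_eq_right]
        constructor
        · rintro ⟨s, hs, h⟩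
          exact ⟨s, hs, h⟩
        · rintro ⟨s, hs, h⟩
          exact ⟨s, hs, h⟩
      rw [hCeq]
      exact isClosedMap_snd_of_compactSpace _ hF
    have hsub : (U₀ ∩ U₁) ∩ A ⊆ C := by
      rintro q ⟨hqV, s, hs⟩
      exact ⟨s, ⟨(hkey q hqV s hs).2, (hkey q hqV s hs).1⟩, subset_closure hs⟩
    have hpC : p ∈ C := by
      have h1 : p ∈ closure ((U₀ ∩ U₁) ∩ A) := hVo.inter_closure ⟨⟨hpU₀, hpU₁⟩, hpA⟩
      exact hCc.closure_subset_iff.2 hsub h1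
    obtain ⟨s, -, hs⟩ := hpC
    exact ⟨s, 𝒮.closure_carrierSet_inter_doc_subset ⟨hs, hDinv s p hp⟩⟩
  exact 𝓑.isConnected_doc.isPreconnected.subset_of_closure_inter_subset hAo hne hcl hp

/-- **The partition `⟨⟨M_ext⟩⟩ ⊆ I⁺(S) ∪ S ∪ I⁻(S)` in the strictly stationary case** (the hypothesis
`hpart` of `DocOrbitsMeetHypersurface.lean`, here PROVED when `K` is timelike on `⟨⟨M_ext⟩⟩`): the
orbit of `p ∈ ⟨⟨M_ext⟩⟩` is a future timelike curve meeting `S` at `φₛ p`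
(`exists_flow_mem_carrierSet_of_isTimelike`), so `p ∈ I⁻(S)`, `p ∈ S` or `p ∈ I⁺(S)` according as
`s > 0`, `s = 0` or `s < 0`. Chruściel–Costa 2008, §4.2 (proof of Thm. 4.5: "Since `S` is achronal
it partitions `⟨⟨M_ext⟩⟩` as `⟨⟨M_ext⟩⟩ = I⁺(S) ∪ S ∪ I⁻(S)`"). [cite: ChruscielCosta2008, §4.2 (proof of Thm. 4.5)] -/
theorem doc_subset_of_isTimelike [𝓑.metric.HasLeviCivita] (𝒮 : 𝓑.IPlusRegularHypersurface)
    (hT : ∀ p ∈ 𝓑.doc, 𝓑.metric.IsTimelike (𝓑.killing p)) :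
    𝓑.doc ⊆ 𝓑.metric.chronologicalFuture 𝓑.timeOrientation 𝒮.carrierSet ∪ 𝒮.carrierSet ∪
      𝓑.metric.chronologicalPast 𝓑.timeOrientation 𝒮.carrierSet := by
  intro p hp
  obtain ⟨θ, hθ, hθ0, hθadd, hθX, -⟩ := 𝓑.exists_stationary_flow
  obtain ⟨s, hs⟩ := 𝒮.exists_flow_mem_carrierSet_of_isTimelike hT hθ hθ0 hθadd hθX hp
  have hDinv : ∀ u : ℝ, θ (u, p) ∈ 𝓑.doc := fun u ↦
    mem_doc_of_isMIntegralCurve (hθX p) (by simpa only [hθ0] using hp) u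
  have hll : ∀ a b : ℝ, a < b →
      θ (b, p) ∈ 𝓑.metric.chronologicalFuture 𝓑.timeOrientation {θ (a, p)} := fun a b hab ↦
    LorentzianMetric.apply_mem_chronologicalFuture_of_isMIntegralCurve (hθX p) hab
      fun u _ ↦ ⟨hT _ (hDinv u), isFutureDirected_killing_of_forall_isTimelike hT (hDinv u)⟩
  rcases lt_trichotomy s 0 with hs0 | rfl | hs0
  · -- `φₛ p ≪ p`: `p ∈ I⁺(S)`
    left; left
    have h := hll s 0 hs0
    rw [hθ0] at h
    exact LorentzianMetric.chronologicalFuture_mono (Set.singleton_subset_iff.2 hs) h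
  · left; right
    rwa [hθ0] at hs
  · -- `p ≪ φₛ p`: `p ∈ I⁻(S)`
    right
    have h := hll 0 s hs0
    rw [hθ0] at h
    exact LorentzianMetric.chronologicalPast_mono (Set.singleton_subset_iff.2 hs)
      (LorentzianMetric.mem_chronologicalPast_of_mem_chronologicalFuture h)

/-- **Chruściel–Costa's Thm. 4.5 (time function with spacelike level sets), strictly stationary
case, unconditionally.**  For a stationary asymptotically flat black hole admitting a hypersurface
`S` as in Def. 1.1 (in particular for an `I⁺`-regular one) whose stationary Killing field is
timelike on the whole of `⟨⟨M_ext⟩⟩`, there is a function `t`, `C^∞` on `⟨⟨M_ext⟩⟩`, with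
`t (γ s) = t (γ 0) + s` along the Killing orbits from `⟨⟨M_ext⟩⟩` and `dt_x(k) ≠ 0` for all
`x ∈ ⟨⟨M_ext⟩⟩` and non-zero causal `k` — the conclusion of `chruscielCosta2008_spacelikeTimeFunction`
for `𝓑` (`exists_spacelikeTimeFunction_of_isTimelike` with the partition supplied by
`doc_subset_of_isTimelike`). Chruściel–Costa 2008, §4.2, Thm. 4.5. [cite: ChruscielCosta2008, Thm. 4.5] -/
theorem exists_spacelikeTimeFunction_of_isTimelike' [𝓑.metric.HasLeviCivita]
    (𝒮 : 𝓑.IPlusRegularHypersurface) (hT : ∀ p ∈ 𝓑.doc, 𝓑.metric.IsTimelike (𝓑.killing p)) :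
    ∃ t : 𝓑.carrier → ℝ,
      ContMDiffOn (𝓡 4) 𝓘(ℝ, ℝ) ((⊤ : ℕ∞) : WithTop ℕ∞) t 𝓑.doc ∧
      (∀ γ : ℝ → 𝓑.carrier, IsMIntegralCurve γ 𝓑.killing → γ 0 ∈ 𝓑.doc →
        ∀ s : ℝ, t (γ s) = t (γ 0) + s) ∧
      ∀ x ∈ 𝓑.doc, ∀ k : TangentSpace (𝓡 4) x, 𝓑.metric.val x k k ≤ 0 → k ≠ 0 →
        mvfderiv (𝓡 4) t x k ≠ 0 :=
  𝒮.exists_spacelikeTimeFunction_of_isTimelike hT (𝒮.doc_subset_of_isTimelike hT)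

/-- **The strictly stationary case of the named fact `chruscielCosta2008_spacelikeTimeFunction`, as
an instance of its statement**: for an `I⁺`-regular stationary asymptotically flat black hole
(vacuum is not needed) whose Killing field is timelike on `⟨⟨M_ext⟩⟩`, the conclusion of the fact
holds. Chruściel–Costa 2008, Thm. 4.5. [cite: ChruscielCosta2008, Thm. 4.5] -/
theorem _root_.Literature.Geometry.Lorentzian.StationaryAFBlackHole.IsIPlusRegular.exists_spacelikeTimeFunction_of_isTimelike
    [𝓑.metric.HasLeviCivita] (hreg : 𝓑.IsIPlusRegular)
    (hT : ∀ p ∈ 𝓑.doc, 𝓑.metric.IsTimelike (𝓑.killing p)) :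
    ∃ t : 𝓑.carrier → ℝ,
      ContMDiffOn (𝓡 4) 𝓘(ℝ, ℝ) ((⊤ : ℕ∞) : WithTop ℕ∞) t 𝓑.doc ∧
      (∀ γ : ℝ → 𝓑.carrier, IsMIntegralCurve γ 𝓑.killing → γ 0 ∈ 𝓑.doc →
        ∀ s : ℝ, t (γ s) = t (γ 0) + s) ∧
      ∀ x ∈ 𝓑.doc, ∀ k : TangentSpace (𝓡 4) x, 𝓑.metric.val x k k ≤ 0 → k ≠ 0 →
        mvfderiv (𝓡 4) t x k ≠ 0 :=
  hreg.nonempty_hypersurface.some.exists_spacelikeTimeFunction_of_isTimelike' hT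

end StationaryAFBlackHole.IPlusRegularHypersurface

/-- **Reduction of `chruscielCosta2008_spacelikeTimeFunction` to the existence of spacelike flow
sections.**  The named fact (Chruściel–Costa 2008, Thm. 4.5, time-function part with spacelike
level sets) follows from: for every vacuum `I⁺`-regular stationary asymptotically flat black hole
and (any presentation `θ` of) its stationary flow, there is a subset `𝒮₀` of space-time, locally
the zero set of smooth functions with timelike differential not annihilating `K`, met exactly
once by the orbit of every point of `⟨⟨M_ext⟩⟩` — which is what §4.2 constructs before its last
paragraph (Prop. 4.4, Prop. 4.6, the hypersurfaces `C⁺_ε` of the cone-widened metrics `g_ε` and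
their mollification `u_{ε,η}`, Lemmas 4.7–4.9, and the extension of the zero level set to large
distances along `S`), on one asymptotically flat end (Thm. 2.3 under the null energy condition).
This theorem is the formal statement of that dependency; it does not discharge the fact.
[cite: ChruscielCosta2008, Thm. 4.5 (proof), Prop. 4.4, Prop. 4.6] -/
theorem chruscielCosta2008_spacelikeTimeFunction_of_sections
    (H : ∀ (𝓑 : StationaryAFBlackHole.{0}) [𝓑.metric.HasLeviCivita],
      𝓑.metric.toPseudoRiemannianMetric.IsRicciFlat → 𝓑.IsIPlusRegular →
      ∀ θ : ℝ × 𝓑.carrier → 𝓑.carrier, ContMDiff (𝓘(ℝ, ℝ).prod (𝓡 4)) (𝓡 4) ∞ θ →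
        (∀ p, θ (0, p) = p) → (∀ t s p, θ (t, θ (s, p)) = θ (t + s, p)) →
        (∀ p, IsMIntegralCurve (fun t ↦ θ (t, p)) 𝓑.killing) →
        ∃ S : Set 𝓑.carrier,
          (∀ x ∈ S, ∃ (f : 𝓑.carrier → ℝ) (U : Set 𝓑.carrier), IsOpen U ∧ x ∈ U ∧
            ContMDiffAt (𝓡 4) 𝓘(ℝ, ℝ) ∞ f x ∧ (∀ y ∈ U, y ∈ S ↔ f y = 0) ∧
            mfderiv (𝓡 4) 𝓘(ℝ, ℝ) f x (𝓑.killing x) ≠ 0 ∧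
            ∀ k : TangentSpace (𝓡 4) x, 𝓑.metric.val x k k ≤ 0 → k ≠ 0 →
              mfderiv (𝓡 4) 𝓘(ℝ, ℝ) f x k ≠ 0) ∧
          ∀ p ∈ 𝓑.doc, ∃! s : ℝ, θ (s, p) ∈ S) :
    chruscielCosta2008_spacelikeTimeFunction := by
  intro 𝓑 _ hvac hreg
  obtain ⟨θ, hθ, hθ0, hθadd, hθX, hiso, -⟩ := 𝓑.exists_stationary_flow
  obtain ⟨S, hloc, honce⟩ := H 𝓑 hvac hreg θ hθ hθ0 hθadd hθX
  exact 𝓑.exists_spacelikeTimeFunction_of_section hθ hθ0 hθadd hθX hiso hloc honce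

/-! ### Smooth dependence of interval integrals on a manifold point -/

section ParametricIntegral

variable {E : Type*} [NormedAddCommGroup E] [NormedSpace ℝ E] [FiniteDimensional ℝ E]
  {H : Type*} [TopologicalSpace H] {I : ModelWithCorners ℝ E H} [I.Boundaryless]
  {M : Type*} [TopologicalSpace M] [ChartedSpace H M] [IsManifold I ∞ M]
  {F' : Type*} [NormedAddCommGroup F'] [NormedSpace ℝ F']

/-- A smooth cutoff equal to `1` near a compact subset `K` of an open set `U` of a
finite-dimensional real normed space, with support inside `U` (Mathlib's
`exists_contMDiffMap_one_nhds_of_subset_interior` on a compact thickening of `K`). [folklore] -/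
theorem exists_contDiff_tsupport_subset_eventually_nhdsSet_eq_one {V : Type*}
    [NormedAddCommGroup V] [NormedSpace ℝ V] [FiniteDimensional ℝ V] {K U : Set V}
    (hK : IsCompact K) (hU : IsOpen U) (hKU : K ⊆ U) :
    ∃ χ : V → ℝ, ContDiff ℝ ∞ χ ∧ tsupport χ ⊆ U ∧ ∀ᶠ y in 𝓝ˢ K, χ y = 1 := by
  obtain ⟨δ, hδ, hδU⟩ := hK.exists_cthickening_subset_open hU hKU
  have hKint : K ⊆ interior (Metric.cthickening δ K) :=
    (Metric.self_subset_thickening hδ K).trans (Metric.thickening_subset_interior_cthickening δ K)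
  obtain ⟨f, hf1, hf0, -⟩ :=
    exists_contMDiffMap_one_nhds_of_subset_interior 𝓘(ℝ, V) hK.isClosed hKint (n := ⊤)
  have hsupp : tsupport f ⊆ Metric.cthickening δ K :=
    closure_minimal (fun y hy ↦ by_contra fun h ↦ hy (hf0 y h)) Metric.isClosed_cthickening
  exact ⟨f, contMDiff_iff_contDiff.1 f.contMDiff, hsupp.trans hδU, hf1⟩

/-- **Smooth dependence of `∫ₐᵇ g (s, p) ds` on a manifold point `p`.** If `g : ℝ × M → F'` is
`C^∞` on an open set `W ⊇ [[a, b]] × {p₀}` of the product manifold, then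
`p ↦ ∫ s in a..b, g (s, p)` is `C^∞` at `p₀`: in a chart at `p₀` the integrand is `C^∞` on an
open neighbourhood of the compact segment `[[a, b]] × {x₀}`; multiplied by a smooth cutoff equal
to `1` near the segment it becomes a globally `C^∞` integrand with the same integrals near `x₀`,
to which differentiation under the integral sign to all orders
(`contDiff_parametric_intervalIntegral`) applies. Hörmander, *ALPDO I*, Thm. 1.1.9; Lee 2012,
Lemma C.39 ff. [folklore] -/
theorem contMDiffAt_intervalIntegral {g : ℝ × M → F'} {W : Set (ℝ × M)} (hW : IsOpen W)
    (hg : ContMDiffOn (𝓘(ℝ, ℝ).prod I) 𝓘(ℝ, F') ∞ g W) {a b : ℝ} {p₀ : M}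
    (hab : ∀ s ∈ uIcc a b, (s, p₀) ∈ W) :
    ContMDiffAt I 𝓘(ℝ, F') ∞ (fun p ↦ ∫ s in a..b, g (s, p)) p₀ := by
  -- chart representative of the integrand
  set G : ℝ × E → F' := fun z ↦ g (z.1, (extChartAt I p₀).symm z.2) with hG_def
  set W' : Set (ℝ × E) :=
    (univ ×ˢ (extChartAt I p₀).target) ∩ (fun z : ℝ × E ↦ (z.1, (extChartAt I p₀).symm z.2)) ⁻¹' W
    with hW'_def
  have hΨc : ContinuousOn (fun z : ℝ × E ↦ (z.1, (extChartAt I p₀).symm z.2))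
      (univ ×ˢ (extChartAt I p₀).target) :=
    continuous_fst.continuousOn.prodMk
      ((continuousOn_extChartAt_symm p₀).comp continuous_snd.continuousOn fun z hz ↦ hz.2)
  have hW'o : IsOpen W' :=
    hΨc.isOpen_inter_preimage (isOpen_univ.prod (isOpen_extChartAt_target p₀)) hW
  have hΨs : ContMDiffOn (𝓘(ℝ, ℝ).prod 𝓘(ℝ, E)) (𝓘(ℝ, ℝ).prod I) ∞
      (fun z : ℝ × E ↦ (z.1, (extChartAt I p₀).symm z.2)) (univ ×ˢ (extChartAt I p₀).target) :=
    contMDiffOn_fst.prodMk ((contMDiffOn_extChartAt_symm p₀).comp contMDiffOn_snd fun z hz ↦ hz.2)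
  have hGs : ContMDiffOn (𝓘(ℝ, ℝ).prod 𝓘(ℝ, E)) 𝓘(ℝ, F') ∞ G W' :=
    hg.comp (hΨs.mono inter_subset_left) fun z hz ↦ hz.2
  have hGs' : ContDiffOn ℝ ∞ G W' := by
    have h : ContMDiffOn 𝓘(ℝ, ℝ × E) 𝓘(ℝ, F') ∞ G W' := by
      rw [modelWithCornersSelf_prod, ← chartedSpaceSelf_prod]; exact hGs
    exact contMDiffOn_iff_contDiffOn.1 h
  -- the compact segment `[[a, b]] × {x₀}` lies in `W'`
  have hx₀ : (extChartAt I p₀).symm (extChartAt I p₀ p₀) = p₀ := extChartAt_to_inv p₀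
  have hKW' : uIcc a b ×ˢ ({extChartAt I p₀ p₀} : Set E) ⊆ W' := by
    rintro ⟨s, x⟩ ⟨hs, hx⟩
    rw [mem_singleton_iff] at hx
    subst hx
    refine ⟨⟨mem_univ _, mem_extChartAt_target p₀⟩, ?_⟩
    show (s, (extChartAt I p₀).symm (extChartAt I p₀ p₀)) ∈ W
    rw [hx₀]; exact hab s hs
  -- cutoff equal to one near the segment, supported in `W'`
  obtain ⟨χ, hχ, hχW, hχ1⟩ := exists_contDiff_tsupport_subset_eventually_nhdsSet_eq_one
    (isCompact_uIcc.prod isCompact_singleton) hW'o hKW'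
  set Gχ : ℝ × E → F' := fun z ↦ χ z • G z with hGχ_def
  have hGχ : ContDiff ℝ ∞ Gχ := by
    rw [contDiff_iff_contDiffAt]
    intro z
    by_cases hz : z ∈ W'
    · exact hχ.contDiffAt.smul (hGs'.contDiffAt (hW'o.mem_nhds hz))
    · have hz' : z ∉ tsupport χ := fun h ↦ hz (hχW h)
      have hev : Gχ =ᶠ[𝓝 z] fun _ ↦ (0 : F') := by
        filter_upwards [notMem_tsupport_iff_eventuallyEq.1 hz'] with y hy
        simp [hGχ_def, hy]
      exact (contDiffAt_const (c := (0 : F'))).congr_of_eventuallyEq hev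
  have hInt : ContDiff ℝ ∞ fun x : E ↦ ∫ s in a..b, Gχ (s, x) :=
    Literature.Analysis.FunctionSpaces.contDiff_parametric_intervalIntegral hGχ a b
  -- near `x₀` the cutoff is invisible
  obtain ⟨O, hOo, hKO, hOχ⟩ := mem_nhdsSet_iff_exists.1 hχ1
  obtain ⟨u, v, -, hv, hKu, hx₀v, huv⟩ :=
    generalized_tube_lemma isCompact_uIcc isCompact_singleton hOo hKO
  have hx₀v' : extChartAt I p₀ p₀ ∈ v := hx₀v (mem_singleton _)
  have hEq : (fun x : E ↦ ∫ s in a..b, G (s, x)) =ᶠ[𝓝 (extChartAt I p₀ p₀)]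
      fun x : E ↦ ∫ s in a..b, Gχ (s, x) := by
    filter_upwards [hv.mem_nhds hx₀v'] with x hx
    refine intervalIntegral.integral_congr fun s hs ↦ ?_
    have h1 : χ (s, x) = 1 := hOχ (huv (mk_mem_prod (hKu hs) hx))
    simp [hGχ_def, h1]
  have hAt : ContDiffAt ℝ ∞ (fun x : E ↦ ∫ s in a..b, G (s, x)) (extChartAt I p₀ p₀) :=
    hInt.contDiffAt.congr_of_eventuallyEq hEq
  -- back to the manifold
  have hEq' : (fun p ↦ ∫ s in a..b, g (s, p)) =ᶠ[𝓝 p₀]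
      (fun x : E ↦ ∫ s in a..b, G (s, x)) ∘ extChartAt I p₀ := by
    filter_upwards [extChartAt_source_mem_nhds (I := I) p₀] with p hp
    simp only [comp_apply, hG_def, (extChartAt I p₀).left_inv hp]
  exact ((contMDiffAt_iff_contDiffAt.2 hAt).comp p₀ contMDiffAt_extChartAt).congr_of_eventuallyEq
    hEq'

end ParametricIntegral

/-! ### Wald's averaging construction (Chruściel–Costa 2008, Prop. 4.6) -/

section WaldAveraging

/-- Changing the lower limit below the support does not change the integral: if `φ = 0` on
`(-∞, m]` and `ℓ₁, ℓ₂ ≤ m` then `∫_{ℓ₁}^r φ = ∫_{ℓ₂}^r φ`. [folklore] -/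
private theorem intervalIntegral_eq_of_le_of_eqOn_zero {φ : ℝ → ℝ} (hφ : Continuous φ)
    {m ℓ₁ ℓ₂ : ℝ} (h0 : ∀ u ≤ m, φ u = 0) (h₁ : ℓ₁ ≤ m) (h₂ : ℓ₂ ≤ m) (r : ℝ) :
    ∫ u in ℓ₁..r, φ u = ∫ u in ℓ₂..r, φ u := by
  have hint : ∀ a b, IntervalIntegrable φ MeasureTheory.volume a b :=
    fun a b ↦ hφ.intervalIntegrable a b
  have h12 : ∫ u in ℓ₁..ℓ₂, φ u = 0 := by
    rw [intervalIntegral.integral_congr (g := fun _ ↦ (0 : ℝ)) fun u hu ↦ ?_,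
      intervalIntegral.integral_zero]
    exact h0 u (hu.2.trans (sup_le h₁ h₂))
  rw [← intervalIntegral.integral_add_adjacent_intervals (hint ℓ₁ ℓ₂) (hint ℓ₂ r), h12, zero_add]

/-- **The one-variable heart of Wald's argument.** Let `φ : ℝ → [0, 1]` be continuous, `= 0` on
`(-∞, t₀]` and `= 1` on `(t₁, ∞)`, with `t₁ - t₀ < T`, `0 < T`, and put `G r := ∫_{t₀}^r φ`.
Then `G` is non-decreasing, the equation `G r = T` has exactly one solution, and every solution
has `r > t₁` ("`F` is strictly increasing along the orbits at points at which `F ≥ T`, since such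
points must lie in `M₊`, where `f = 1`"). [cite: ChruscielCosta2008, Prop. 4.6 (proof)] -/
private theorem wald_aux {φ : ℝ → ℝ} (hφ : Continuous φ) (hφ0 : ∀ u, 0 ≤ φ u)
    (hφ1 : ∀ u, φ u ≤ 1) {t₀ t₁ T : ℝ} (hT : t₁ - t₀ < T) (hT0 : 0 < T)
    (hlo : ∀ u ≤ t₀, φ u = 0) (hhi : ∀ u > t₁, φ u = 1) :
    Monotone (fun r ↦ ∫ u in t₀..r, φ u) ∧ (∀ r, ∫ u in t₀..r, φ u = T → t₁ < r) ∧
      ∃! r, ∫ u in t₀..r, φ u = T := by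
  set G : ℝ → ℝ := fun r ↦ ∫ u in t₀..r, φ u with hG_def
  have hint : ∀ a b, IntervalIntegrable φ MeasureTheory.volume a b :=
    fun a b ↦ hφ.intervalIntegrable a b
  have hderiv : ∀ r, HasDerivAt G (φ r) r := fun r ↦ (hφ.integral_hasStrictDerivAt t₀ r).hasDerivAt
  have hmono : Monotone G :=
    monotone_of_deriv_nonneg (fun r ↦ (hderiv r).differentiableAt) fun r ↦ by
      rw [(hderiv r).deriv]; exact hφ0 r
  have hG0 : G t₀ = 0 := intervalIntegral.integral_same
  have hle : ∀ r, t₀ ≤ r → G r ≤ r - t₀ := by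
    intro r hr
    calc G r ≤ ∫ _ in t₀..r, (1 : ℝ) :=
          intervalIntegral.integral_mono_on hr (hint t₀ r) (by simp) fun u _ ↦ hφ1 u
      _ = r - t₀ := by simp
  have hgt : ∀ r r', t₁ < r → r ≤ r' → G r' - G r = r' - r := by
    intro r r' hr hrr'
    have h1 : G r' - G r = ∫ u in r..r', φ u :=
      intervalIntegral.integral_interval_sub_left (hint t₀ r') (hint t₀ r)
    rw [h1, intervalIntegral.integral_congr (g := fun _ ↦ (1 : ℝ)) fun u hu ↦ ?_]
    · simp
    · exact hhi u (hr.trans_le (by simpa [inf_eq_left.2 hrr'] using hu.1))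
  have hcross : ∀ r, G r = T → t₁ < r := by
    intro r hr
    by_contra hle'
    rw [not_lt] at hle'
    rcases le_or_gt r t₀ with h | h
    · have h1 : G r = 0 := by
        rw [hG_def]
        dsimp only
        rw [intervalIntegral.integral_congr (g := fun _ ↦ (0 : ℝ)) fun u hu ↦ ?_,
          intervalIntegral.integral_zero]
        exact hlo u (hu.2.trans (sup_le le_rfl h))
      exact hT0.ne' (hr.symm.trans h1)
    · have h2 : G r ≤ r - t₀ := hle r h.le
      linarith
  refine ⟨hmono, hcross, ?_⟩
  -- existence by the intermediate value theorem
  set r₁ : ℝ := max t₀ t₁ + 1 with hr₁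
  have hr₁t₁ : t₁ < r₁ := by rw [hr₁]; linarith [le_max_right t₀ t₁]
  have hr₁t₀ : t₀ ≤ r₁ := by rw [hr₁]; linarith [le_max_left t₀ t₁]
  have hGr₂ : T ≤ G (r₁ + T) := by
    have h1 : G (r₁ + T) - G r₁ = r₁ + T - r₁ := hgt r₁ (r₁ + T) hr₁t₁ (by linarith)
    have h2 : 0 ≤ G r₁ := hG0 ▸ hmono hr₁t₀
    linarith
  have hcont : Continuous G := continuous_iff_continuousAt.2 fun r ↦ (hderiv r).continuousAt
  obtain ⟨r, -, hr⟩ : T ∈ G '' Icc t₀ (r₁ + T) :=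
    intermediate_value_Icc (by linarith) hcont.continuousOn ⟨by rw [hG0]; exact hT0.le, hGr₂⟩
  refine ⟨r, hr, fun r' hr' ↦ ?_⟩
  -- uniqueness: two solutions lie beyond `t₁`, where `G` has slope one
  have hr'' : G r' = T := hr'
  rcases le_total r r' with h | h
  · have := hgt r r' (hcross r hr) h
    rw [hr, hr''] at this
    linarith
  · have := hgt r' r (hcross r' hr'') h
    rw [hr, hr''] at this
    linarith

variable {E : Type*} [NormedAddCommGroup E] [NormedSpace ℝ E] [FiniteDimensional ℝ E]
  {H : Type*} [TopologicalSpace H] {I : ModelWithCorners ℝ E H} [I.Boundaryless]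
  {M : Type*} [TopologicalSpace M] [ChartedSpace H M] [IsManifold I ∞ M]
  {X : Π x : M, TangentSpace I x} {θ : ℝ × M → M}

/-- **Wald's averaging function (Chruściel–Costa 2008, Prop. 4.6 and its proof; R. Wald, private
communication to the authors).** Let `θ` be a `C^∞` complete flow on `M` (group law, `θ₀ = id`)
and `f : M → [0, 1]` a `C^∞` function with `f = 0` on `M₋` and `f = 1` on `M₊`; suppose there is
`T` such that for every orbit there is an interval `[t₀, t₁]` with `t₁ - t₀ < T` such that
`θ (t, p) ∈ M₋` for `t < t₀` and `θ (t, p) ∈ M₊` for `t > t₁` (uniform transit). Then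
"`F (p) = ∫_{-∞}^0 f ∘ φ_s (p) ds`" is a `C^∞` function on `M`, "increasing monotonically from zero
to infinity along every orbit", with `(d/dt) F (θ (t, p))|₀ = f (p)`, and "strictly increasing along
the orbits at points at which `F ≥ T` (since such points must lie in `M₊`, where `f = 1`)": every
orbit meets the level set `{F = T}` exactly once, and `f = 1` there. Printed for a manifold
possibly with boundary (`∂S₀ ⊆ ∂M`, `X` tangent to `∂M`); recorded for manifolds without boundary,
the sets `M_±` entering only through `f`.
-- TODO(general form): manifolds with boundary, `X` tangent to `∂M`.
[cite: ChruscielCosta2008, Prop. 4.6] -/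
theorem exists_wald_averaging_function (hθ : ContMDiff (𝓘(ℝ, ℝ).prod I) I ∞ θ)
    (hθ0 : ∀ p, θ (0, p) = p) (hθadd : ∀ t s p, θ (t, θ (s, p)) = θ (t + s, p))
    {f : M → ℝ} (hf : ContMDiff I 𝓘(ℝ, ℝ) ∞ f) (hf0 : ∀ x, 0 ≤ f x) (hf1 : ∀ x, f x ≤ 1)
    {Mm Mp : Set M} (hfMm : ∀ x ∈ Mm, f x = 0) (hfMp : ∀ x ∈ Mp, f x = 1) {T : ℝ}
    (htransit : ∀ p, ∃ t₀ t₁ : ℝ, t₁ - t₀ < T ∧ (∀ t < t₀, θ (t, p) ∈ Mm) ∧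
      ∀ t > t₁, θ (t, p) ∈ Mp) :
    ∃ F : M → ℝ, ContMDiff I 𝓘(ℝ, ℝ) ∞ F ∧
      (∀ p, HasDerivAt (fun t ↦ F (θ (t, p))) (f p) 0) ∧
      (∀ p (s t : ℝ), s ≤ t → F (θ (s, p)) ≤ F (θ (t, p))) ∧
      (∀ p, ∃! t : ℝ, F (θ (t, p)) = T) ∧
      ∀ p, F p = T → f p = 1 := by
  choose t₀ t₁ hT hMm hMp using htransit
  -- the orbit functions `φ_p (u) = f (θ (u, p))`
  set φ : M → ℝ → ℝ := fun p u ↦ f (θ (u, p)) with hφ_def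
  have hφc : ∀ p, Continuous (φ p) := fun p ↦
    hf.continuous.comp (hθ.continuous.comp (continuous_id.prodMk continuous_const))
  have hφ0 : ∀ p u, 0 ≤ φ p u := fun p u ↦ hf0 _
  have hφ1 : ∀ p u, φ p u ≤ 1 := fun p u ↦ hf1 _
  have hlo : ∀ p, ∀ u ≤ t₀ p, φ p u = 0 := by
    intro p u hu
    have hz : Iio (t₀ p) ⊆ {u | φ p u = 0} := fun v hv ↦ hfMm _ (hMm p v hv)
    have hcl : closure (Iio (t₀ p)) ⊆ {u | φ p u = 0} :=
      closure_minimal hz (isClosed_eq (hφc p) continuous_const)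
    exact hcl (by rw [closure_Iio]; exact hu)
  have hhi : ∀ p, ∀ u > t₁ p, φ p u = 1 := fun p u hu ↦ hfMp _ (hMp p u hu)
  have hT0 : ∀ p : M, 0 < T := by
    intro p
    by_contra h
    rw [not_lt] at h
    have h1 : t₁ p < t₀ p := by linarith [hT p]
    have h2 : φ p ((t₁ p + t₀ p) / 2) = 0 := hfMm _ (hMm p _ (by linarith))
    have h3 : φ p ((t₁ p + t₀ p) / 2) = 1 := hhi p _ (by linarith)
    linarith
  -- Wald's function
  set F : M → ℝ := fun p ↦ ∫ u in (t₀ p)..0, φ p u with hF_def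
  have hFlow : ∀ p ℓ, ℓ ≤ t₀ p → F p = ∫ u in ℓ..0, φ p u := fun p ℓ hℓ ↦
    intervalIntegral_eq_of_le_of_eqOn_zero (hφc p) (hlo p) le_rfl hℓ 0
  -- the orbit formula `F (θ (r, p)) = ∫_{t₀ p}^r φ_p`
  have horbit : ∀ p r, F (θ (r, p)) = ∫ u in (t₀ p)..r, φ p u := by
    intro p r
    have h1 : F (θ (r, p)) = ∫ u in (t₀ (θ (r, p)) + r)..(0 + r), φ p u := by
      rw [← intervalIntegral.integral_comp_add_right (φ p) r]
      simp only [hF_def, hφ_def, hθadd]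
    rw [h1, zero_add]
    refine intervalIntegral_eq_of_le_of_eqOn_zero (hφc p) (m := max (t₀ p) (t₀ (θ (r, p)) + r))
      (fun u hu ↦ ?_) (le_max_right _ _) (le_max_left _ _) r
    rcases le_max_iff.1 hu with h | h
    · exact hlo p u h
    · have h2 : φ (θ (r, p)) (u - r) = 0 := hlo _ _ (by linarith)
      simpa [hφ_def, hθadd] using h2
  have haux : ∀ p, Monotone (fun r ↦ ∫ u in (t₀ p)..r, φ p u) ∧
      (∀ r, ∫ u in (t₀ p)..r, φ p u = T → t₁ p < r) ∧ ∃! r, ∫ u in (t₀ p)..r, φ p u = T :=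
    fun p ↦ wald_aux (hφc p) (hφ0 p) (hφ1 p) (hT p) (hT0 p) (hlo p) (hhi p)
  refine ⟨F, fun p₀ ↦ ?_, fun p ↦ ?_, fun p s t hst ↦ ?_, fun p ↦ ?_, fun p hp ↦ ?_⟩
  · -- smoothness at `p₀`: a uniform lower limit near `p₀`
    set c : ℝ := t₀ p₀ - 1 with hc
    have hU₀o : IsOpen {p : M | θ (c, p) ∉ closure Mp} := by
      have h1 : Continuous fun p : M ↦ θ (c, p) :=
        hθ.continuous.comp (continuous_const.prodMk continuous_id)
      exact (isClosed_closure.preimage h1).isOpen_compl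
    have hcl1 : ∀ x ∈ closure Mp, f x = 1 :=
      fun x hx ↦ closure_minimal (fun y hy ↦ hfMp y hy) (isClosed_eq hf.continuous continuous_const) hx
    have hp₀U : p₀ ∈ {p : M | θ (c, p) ∉ closure Mp} := by
      intro h
      have h1 : f (θ (c, p₀)) = 1 := hcl1 _ h
      have h2 : f (θ (c, p₀)) = 0 := hfMm _ (hMm p₀ c (by rw [hc]; linarith))
      linarith
    have hlow : ∀ p ∈ {p : M | θ (c, p) ∉ closure Mp}, c - T ≤ t₀ p := by
      intro p hp
      by_contra h
      rw [not_le] at h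
      exact hp (subset_closure (hMp p c (by linarith [hT p])))
    have hEq : F =ᶠ[𝓝 p₀] fun p ↦ ∫ u in (c - T)..0, f (θ (u, p)) := by
      filter_upwards [hU₀o.mem_nhds hp₀U] with p hp
      exact hFlow p _ (hlow p hp)
    refine (contMDiffAt_intervalIntegral (I := I) (g := fun z : ℝ × M ↦ f (θ z)) isOpen_univ
      (hf.comp hθ).contMDiffOn fun s _ ↦ mem_univ _).congr_of_eventuallyEq hEq
  · -- flow derivative
    have h1 : (fun t ↦ F (θ (t, p))) = fun r ↦ ∫ u in (t₀ p)..r, φ p u := funext (horbit p)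
    rw [h1]
    have h2 := ((hφc p).integral_hasStrictDerivAt (t₀ p) 0).hasDerivAt
    simpa [hφ_def, hθ0] using h2
  · -- monotone along orbits
    rw [horbit, horbit]; exact (haux p).1 hst
  · -- exactly one crossing of the level `T`
    simpa only [horbit] using (haux p).2.2
  · -- at the crossing `f = 1`
    have h1 : ∫ u in (t₀ p)..0, φ p u = T := by rw [← horbit, hθ0]; exact hp
    have h2 : t₁ p < 0 := (haux p).2.1 0 h1
    have h3 := hhi p 0 h2
    simp only [hφ_def, hθ0] at h3
    exact h3

omit [FiniteDimensional ℝ E] [I.Boundaryless] [IsManifold I ∞ M] in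
/-- The derivative of `F` along the generating field `X` of the flow is the derivative of `F`
along the orbit: if `(d/dt) F (θ (t, p))|₀ = d` then `dF_p (X p) = d`. [folklore] -/
theorem mfderiv_apply_eq_of_hasDerivAt_flow (hθX : ∀ p, IsMIntegralCurve (fun t ↦ θ (t, p)) X)
    (hθ0 : ∀ p, θ (0, p) = p) {F : M → ℝ} {p : M} (hF : MDifferentiableAt I 𝓘(ℝ, ℝ) F p)
    {d : ℝ} (hd : HasDerivAt (fun t ↦ F (θ (t, p))) d 0) :
    mfderiv I 𝓘(ℝ, ℝ) F p (X p) = d := by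
  have hF' : MDifferentiableAt I 𝓘(ℝ, ℝ) F (θ (0, p)) := by rw [hθ0]; exact hF
  have h := hasDerivAt_comp_flow_curve hθX (s := 0) (p := p) hF'
  rw [hθ0 p] at h
  exact h.unique hd

/-- **A smooth hypersurface met exactly once by every orbit (Chruściel–Costa 2008, Prop. 4.6).**
Under the hypotheses of `exists_wald_averaging_function` (smooth complete flow `θ` of `X`,
`f : M → [0, 1]` smooth, `= 0` on `M₋`, `= 1` on `M₊`, uniform transit time `< T` from `M₋` to
`M₊`), "there exists a smooth hypersurface `S₁ ⊂ M` such that every orbit of `X` intersects `S₁`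
once and only once": `S₁ = {F = T}` is the regular zero set of the smooth function `F - T`, with
`d(F - T)(X) = f = 1 ≠ 0` along `S₁` (transversality), and every orbit meets it at exactly one
parameter. [cite: ChruscielCosta2008, Prop. 4.6] -/
theorem exists_flowSection_of_uniformTransit (hθ : ContMDiff (𝓘(ℝ, ℝ).prod I) I ∞ θ)
    (hθ0 : ∀ p, θ (0, p) = p) (hθadd : ∀ t s p, θ (t, θ (s, p)) = θ (t + s, p))
    (hθX : ∀ p, IsMIntegralCurve (fun t ↦ θ (t, p)) X)
    {f : M → ℝ} (hf : ContMDiff I 𝓘(ℝ, ℝ) ∞ f) (hf0 : ∀ x, 0 ≤ f x) (hf1 : ∀ x, f x ≤ 1)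
    {Mm Mp : Set M} (hfMm : ∀ x ∈ Mm, f x = 0) (hfMp : ∀ x ∈ Mp, f x = 1) {T : ℝ}
    (htransit : ∀ p, ∃ t₀ t₁ : ℝ, t₁ - t₀ < T ∧ (∀ t < t₀, θ (t, p) ∈ Mm) ∧
      ∀ t > t₁, θ (t, p) ∈ Mp) :
    ∃ S₁ : Set M, (∀ p, ∃! t : ℝ, θ (t, p) ∈ S₁) ∧
      ∀ x ∈ S₁, ∃ (F : M → ℝ) (U : Set M), IsOpen U ∧ x ∈ U ∧
        ContMDiffAt I 𝓘(ℝ, ℝ) ∞ F x ∧ (∀ y ∈ U, y ∈ S₁ ↔ F y = 0) ∧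
        mfderiv I 𝓘(ℝ, ℝ) F x (X x) ≠ 0 := by
  obtain ⟨F, hFs, hFd, -, honce, hone⟩ :=
    exists_wald_averaging_function (I := I) hθ hθ0 hθadd hf hf0 hf1 hfMm hfMp htransit
  refine ⟨{x | F x = T}, fun p ↦ by simpa only [mem_setOf_eq] using honce p, fun x hx ↦ ?_⟩
  refine ⟨fun y ↦ F y - T, univ, isOpen_univ, mem_univ _, (hFs x).sub contMDiffAt_const,
    fun y _ ↦ by simp [sub_eq_zero], ?_⟩
  have hd : HasDerivAt (fun t ↦ F (θ (t, x)) - T) (f x) 0 := (hFd x).sub_const T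
  have hFd' : MDifferentiableAt I 𝓘(ℝ, ℝ) (fun y ↦ F y - T) x :=
    ((hFs x).sub contMDiffAt_const).mdifferentiableAt (by simp)
  rw [mfderiv_apply_eq_of_hasDerivAt_flow hθX hθ0 hFd' hd, hone x hx]
  exact (one_ne_zero : (1 : ℝ) ≠ 0)

end WaldAveraging

/-! ### The retarded Killing time of an `I⁺`-regular domain of outer communications -/

namespace StationaryAFBlackHole

variable {𝓑 : StationaryAFBlackHole.{u}} [𝓑.metric.HasLeviCivita]

omit [𝓑.metric.HasLeviCivita] in
/-- Push-up, second form, for the space-time of `𝓑`: `x ≪ y ≤ z ⇒ x ≪ z` (time dual of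
`LorentzianMetric.mem_chronologicalFuture_of_mem_causalFuture`). O'Neill 1983, Ch. 14, Cor. 14.1.
[cite: ONeillSemiRiemannian1983, Ch. 14, Cor. 14.1 (p. 402)] -/
private theorem mem_chronologicalFuture_of_ll_of_le {x y z : 𝓑.carrier}
    (hy : y ∈ 𝓑.metric.chronologicalFuture 𝓑.timeOrientation {x})
    (hz : z ∈ 𝓑.metric.causalFuture 𝓑.timeOrientation {y}) :
    z ∈ 𝓑.metric.chronologicalFuture 𝓑.timeOrientation {x} := by
  have hy' : y ∈ 𝓑.metric.causalFuture 𝓑.timeOrientation.reverse {z} :=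
    LorentzianMetric.mem_causalPast_singleton_iff.2 hz
  have hx' : x ∈ 𝓑.metric.chronologicalFuture 𝓑.timeOrientation.reverse {y} :=
    LorentzianMetric.mem_chronologicalPast_of_mem_chronologicalFuture hy
  exact LorentzianMetric.mem_chronologicalFuture_of_mem_chronologicalPast
    (LorentzianMetric.mem_chronologicalFuture_of_mem_causalFuture
      (τ := 𝓑.timeOrientation.reverse) (by exact_mod_cast le_top) hy' hx')

/-- **The retarded Killing time of an `I⁺`-regular domain of outer communications: a continuous,
flow-equivariant, causal (isotone) function on `⟨⟨M_ext⟩⟩`.**  Let `θ` be the flow of the stationary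
Killing field and `q₀ ∈ M_ext`.  For `p ∈ ⟨⟨M_ext⟩⟩` the set of "emission times"
`A(p) = {t | p ∈ I⁺(φ_t(q₀))}` is open, an initial segment (the orbit of `q₀` is a future timelike
curve), non-empty (`p ∈ I⁺(M_ext)` and the orbit of any point of `M_ext` eventually enters the future
of `q₀`, `exists_orbit_mem_chronologicalFuture`) and bounded above (`p ∈ I⁻(q'')`, `q'' ∈ M_ext`, and
`φ_t(q₀) ≫ q''` for large `t`, so a larger emission time would put `φ_t(q₀)` on a closed timelike
curve, against strong causality of `⟨⟨M_ext⟩⟩`); hence `A(p) = (-∞, u(p))` with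
`u(p) := sup A(p) ∈ ℝ`, **the retarded time of `p` with respect to the observer orbit `φ_ℝ(q₀)`**.
Then: `u (φ_s p) = u (p) + s` (the flow maps are isometries preserving `≪`); `u (p) ≤ u (q)` for
`p ≤ q` in `⟨⟨M_ext⟩⟩` (push-up); and `u` is continuous on `⟨⟨M_ext⟩⟩` — lower semicontinuous because
the `I⁺(φ_t(q₀))` are open, upper semicontinuous because the causal diamonds `J⁺(x) ∩ J⁻(z)`,
`x, z ∈ ⟨⟨M_ext⟩⟩`, are compact (global hyperbolicity of `⟨⟨M_ext⟩⟩`, Def. 1.1), hence closed, so that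
`I⁻(z) ∖ (J⁺(φ_c(q₀)) ∩ J⁻(z))` is a neighbourhood of `p` on which `u < c` whenever `c > u(p)`,
`p ≪ z ∈ M_ext`.  This is the function `u` of Chruściel–Costa 2008, §4.2, (4.14)
("`u (φ_t(p)) = u(p) + t`", with achronal level sets `C⁺_t`, the boundaries `∂J⁺` of the translates
of a sphere in `M_ext`), built here from a point of `M_ext` instead of a sphere, which dispenses
with Prop. 4.4 (compactness of `C⁺`, i.e. with the one-end hypothesis): the level sets of `u` are
the future light cones `∂I⁺(φ_t(q₀)) ∩ ⟨⟨M_ext⟩⟩` of the events of the observer orbit.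
[cite: ChruscielCosta2008, §4.2 (4.12)–(4.14)] -/
theorem IsIPlusRegular.exists_continuousOn_retardedTime (hreg : 𝓑.IsIPlusRegular)
    {θ : ℝ × 𝓑.carrier → 𝓑.carrier} (hθ : ContMDiff (𝓘(ℝ, ℝ).prod (𝓡 4)) (𝓡 4) ∞ θ)
    (hθ0 : ∀ p, θ (0, p) = p) (hθadd : ∀ t s p, θ (t, θ (s, p)) = θ (t + s, p))
    (hθX : ∀ p, IsMIntegralCurve (fun t ↦ θ (t, p)) 𝓑.killing) :
    ∃ u : 𝓑.carrier → ℝ, ContinuousOn u 𝓑.doc ∧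
      (∀ p ∈ 𝓑.doc, ∀ s : ℝ, u (θ (s, p)) = u p + s) ∧
      ∀ p ∈ 𝓑.doc, ∀ q ∈ 𝓑.doc, q ∈ 𝓑.metric.causalFuture 𝓑.timeOrientation {p} → u p ≤ u q := by
  obtain ⟨q₀, hq₀⟩ := 𝓑.Mext_nonempty
  have hK : 𝓑.metric.IsKillingField 𝓑.killing := 𝓑.isStationaryKilling.isKillingField
  have hθ2 : ContMDiff (𝓘(ℝ, ℝ).prod (𝓡 4)) (𝓡 4) 2 θ := hθ.of_le (WithTop.coe_le_coe.mpr le_top)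
  have hD : IsOpen 𝓑.doc :=
    𝓑.isOpen_doc LorentzianMetric.isOpen_chronologicalFuture_holds_of_boundaryless
      LorentzianMetric.isOpen_chronologicalPast_holds_of_boundaryless
  have hDinv : ∀ (s : ℝ) (p : 𝓑.carrier), p ∈ 𝓑.doc → θ (s, p) ∈ 𝓑.doc := by
    intro s p hp
    have h0 : (fun t ↦ θ (t, p)) 0 ∈ 𝓑.doc := by simpa only [hθ0] using hp
    exact mem_doc_of_isMIntegralCurve (hθX p) h0 s
  have hMextθ : ∀ t : ℝ, θ (t, q₀) ∈ 𝓑.Mext := fun t ↦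
    𝓑.Mext_invariant (hθX q₀) (by simpa only [hθ0] using hq₀) t
  -- the observer orbit is a future timelike curve: later points are in the future of earlier ones
  have horb : ∀ a b : ℝ, a < b →
      θ (b, q₀) ∈ 𝓑.metric.chronologicalFuture 𝓑.timeOrientation {θ (a, q₀)} := fun a b hab ↦
    apply_mem_chronologicalFuture_of_mem_Mext (hθX q₀) (by simpa only [hθ0] using hq₀) hab
  -- the flow maps preserve `≪`
  have hflow : ∀ (t : ℝ) {q r : 𝓑.carrier},
      r ∈ 𝓑.metric.chronologicalFuture 𝓑.timeOrientation {q} →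
      θ (t, r) ∈ 𝓑.metric.chronologicalFuture 𝓑.timeOrientation {θ (t, q)} := by
    intro t q r hr
    have h := hK.image_flow_chronologicalFuture (τ := 𝓑.timeOrientation) hθ2 hθ0 hθadd hθX t {q}
    rw [Set.image_singleton] at h
    rw [← h]
    exact Set.mem_image_of_mem _ hr
  -- the emission times
  set A : 𝓑.carrier → Set ℝ :=
    fun p ↦ {t | p ∈ 𝓑.metric.chronologicalFuture 𝓑.timeOrientation {θ (t, q₀)}} with hA_def
  have hAdown : ∀ p (t t' : ℝ), t ∈ A p → t' < t → t' ∈ A p := fun p t t' ht htt' ↦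
    LorentzianMetric.mem_chronologicalFuture_trans (horb t' t htt') ht
  have hAopen : ∀ p, IsOpen (A p) := by
    intro p
    have h1 : A p = (fun t ↦ θ (t, q₀)) ⁻¹' 𝓑.metric.chronologicalPast 𝓑.timeOrientation {p} := by
      ext t
      exact ⟨fun h ↦ LorentzianMetric.mem_chronologicalPast_of_mem_chronologicalFuture h,
        fun h ↦ LorentzianMetric.mem_chronologicalFuture_of_mem_chronologicalPast h⟩
    rw [h1]
    exact (LorentzianMetric.isOpen_chronologicalPast_of_boundaryless _ _ _).preimage
      (hθ.continuous.comp (continuous_id.prodMk continuous_const))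
  have hAshift : ∀ p (s t : ℝ), t ∈ A (θ (s, p)) ↔ t - s ∈ A p := by
    intro p s t
    constructor
    · intro h
      have h1 := hflow (-s) h
      rwa [hθadd, hθadd, neg_add_cancel, hθ0, neg_add_eq_sub] at h1
    · intro h
      have h1 := hflow s h
      rwa [hθadd, add_sub_cancel] at h1
  have hAne : ∀ p ∈ 𝓑.doc, (A p).Nonempty := by
    rintro p ⟨hpF, -⟩
    obtain ⟨q', hq', γ, a, b, hab, hγ, hγa, hγb⟩ := hpF
    have hpq' : p ∈ 𝓑.metric.chronologicalFuture 𝓑.timeOrientation {q'} :=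
      ⟨q', rfl, γ, a, b, hab, hγ, hγa, hγb⟩
    obtain ⟨T, hT⟩ := exists_orbit_mem_chronologicalFuture hq₀ hq' (hθX q') (hθ0 q')
    have h1 : θ (-T, θ (T, q')) ∈
        𝓑.metric.chronologicalFuture 𝓑.timeOrientation {θ (-T, q₀)} := hflow (-T) (hT T le_rfl)
    rw [hθadd, neg_add_cancel, hθ0] at h1
    exact ⟨-T, LorentzianMetric.mem_chronologicalFuture_trans h1 hpq'⟩
  have hAbdd : ∀ p ∈ 𝓑.doc, BddAbove (A p) := by
    rintro p ⟨-, hpP⟩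
    obtain ⟨q'', hq'', γ, a, b, hab, hγ, hγa, hγb⟩ := hpP
    have hpq'' : p ∈ 𝓑.metric.chronologicalPast 𝓑.timeOrientation {q''} :=
      ⟨q'', rfl, γ, a, b, hab, hγ, hγa, hγb⟩
    have hq''p : q'' ∈ 𝓑.metric.chronologicalFuture 𝓑.timeOrientation {p} :=
      LorentzianMetric.mem_chronologicalFuture_of_mem_chronologicalPast hpq''
    obtain ⟨T₀, hT₀⟩ := exists_orbit_mem_chronologicalFuture hq'' hq₀ (hθX q₀) (hθ0 q₀)
    refine ⟨T₀, fun t ht ↦ ?_⟩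
    by_contra hlt
    rw [not_le] at hlt
    -- `φ_t(q₀) ≫ q'' ≫ p ≫ φ_t(q₀)`: a closed timelike curve through a point of the d.o.c.
    have h1 : θ (t, q₀) ∈ 𝓑.metric.chronologicalFuture 𝓑.timeOrientation {q''} := hT₀ t hlt.le
    have h2 : θ (t, q₀) ∈ 𝓑.metric.chronologicalFuture 𝓑.timeOrientation {θ (t, q₀)} :=
      LorentzianMetric.mem_chronologicalFuture_trans
        (LorentzianMetric.mem_chronologicalFuture_trans ht hq''p) h1
    obtain ⟨x, hx, δ, a', b', hab', hδ, hδa, hδb⟩ := h2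
    rw [mem_singleton_iff] at hx
    exact (hreg.isStronglyCausalAt (𝓑.Mext_subset_doc (hMextθ t))).apply_ne_of_isFutureCausalCurveOn
      hab' hδ.isFutureCausalCurveOn (hδa.trans hx) hδb
  -- the retarded time
  set u : 𝓑.carrier → ℝ := fun p ↦ sSup (A p) with hu_def
  have hAeq : ∀ p ∈ 𝓑.doc, A p = Iio (u p) := by
    intro p hp
    ext t
    constructor
    · intro ht
      obtain ⟨ε, hε, hball⟩ := Metric.isOpen_iff.1 (hAopen p) t ht
      have h1 : t + ε / 2 ∈ A p := hball (by
        rw [Metric.mem_ball, Real.dist_eq, add_sub_cancel_left, abs_of_pos (half_pos hε)]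
        exact half_lt_self hε)
      have h2 : t + ε / 2 ≤ u p := le_csSup (hAbdd p hp) h1
      show t < u p
      linarith
    · intro ht
      obtain ⟨t', ht', htt'⟩ := exists_lt_of_lt_csSup (hAne p hp) ht
      exact hAdown p t' t ht' htt'
  refine ⟨u, ?_, fun p hp s ↦ ?_, fun p hp q hq hpq ↦ ?_⟩
  · -- continuity on the d.o.c.
    intro p₀ hp₀
    refine ContinuousAt.continuousWithinAt (tendsto_order.2 ⟨fun c hc ↦ ?_, fun c hc ↦ ?_⟩)
    · -- lower semicontinuity: `I⁺(φ_t(q₀))` is open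
      obtain ⟨t, hct, htu⟩ := exists_between hc
      have ht : t ∈ A p₀ := by rw [hAeq p₀ hp₀]; exact htu
      have h1 : ∀ᶠ p in 𝓝 p₀, t ∈ A p :=
        (LorentzianMetric.isOpen_chronologicalFuture_of_boundaryless _ _ _).mem_nhds ht
      filter_upwards [h1, hD.mem_nhds hp₀] with p hp hpD
      have h2 : t < u p := by
        have h3 : t ∈ Iio (u p) := by rw [← hAeq p hpD]; exact hp
        exact h3
      exact hct.trans h2
    · -- upper semicontinuity: compact causal diamonds
      set c' : ℝ := (u p₀ + c) / 2 with hc'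
      have hc'1 : u p₀ < c' := by rw [hc']; linarith
      have hc'2 : c' < c := by rw [hc']; linarith
      obtain ⟨z, hz, γ, a, b, hab, hγ, hγa, hγb⟩ := hp₀.2
      have hp₀z : p₀ ∈ 𝓑.metric.chronologicalPast 𝓑.timeOrientation {z} :=
        ⟨z, rfl, γ, a, b, hab, hγ, hγa, hγb⟩
      set D : Set 𝓑.carrier := 𝓑.metric.causalFuture 𝓑.timeOrientation {θ (c', q₀)} ∩
        𝓑.metric.causalPast 𝓑.timeOrientation {z} with hD_def
      have hDc : IsClosed D :=
        (hreg.isGloballyHyperbolicSet_doc.isCompact_inter (𝓑.Mext_subset_doc (hMextθ c'))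
          (𝓑.Mext_subset_doc hz)).isClosed
      have hp₀D : p₀ ∉ D := by
        rintro ⟨hp₀J, -⟩
        -- then `φ_{c' - δ}(q₀) ≪ φ_{c'}(q₀) ≤ p₀`, so `c' - δ` is an emission time for every `δ > 0`
        set δ : ℝ := (c' - u p₀) / 2 with hδ
        have hδ0 : 0 < δ := by rw [hδ]; linarith
        have h1 : c' - δ ∈ A p₀ :=
          mem_chronologicalFuture_of_ll_of_le (horb (c' - δ) c' (by linarith)) hp₀J
        have h2 : c' - δ < u p₀ := by
          have h3 : c' - δ ∈ Iio (u p₀) := by rw [← hAeq p₀ hp₀]; exact h1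
          exact h3
        rw [hδ] at h2
        linarith
      have hN : ∀ᶠ p in 𝓝 p₀, p ∈ 𝓑.metric.chronologicalPast 𝓑.timeOrientation {z} ∧ p ∉ D := by
        refine Filter.eventually_of_mem (((LorentzianMetric.isOpen_chronologicalPast_of_boundaryless
          _ _ _).inter hDc.isOpen_compl).mem_nhds ⟨hp₀z, hp₀D⟩) fun p hp ↦ hp
      filter_upwards [hN, hD.mem_nhds hp₀] with p ⟨hpz, hpD⟩ hpdoc
      by_contra hle
      rw [not_lt] at hle
      have h1 : c' ∈ A p := by rw [hAeq p hpdoc]; exact hc'2.trans_le hle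
      exact hpD ⟨LorentzianMetric.chronologicalFuture_subset_causalFuture _ _ _ h1,
        LorentzianMetric.chronologicalFuture_subset_causalFuture _ _ _ hpz⟩
  · -- equivariance
    have h1 : A (θ (s, p)) = Iio (u p + s) := by
      ext t
      rw [hAshift, hAeq p hp]
      simp only [mem_Iio, sub_lt_iff_lt_add]
    show sSup (A (θ (s, p))) = u p + s
    rw [h1]
    exact csSup_Iio
  · -- isotone for the causal relation
    refine csSup_le_csSup (hAbdd q hq) (hAne p hp) fun t ht ↦ ?_
    exact mem_chronologicalFuture_of_ll_of_le ht hpq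

end StationaryAFBlackHole

/-! ### Differentiation under the integral sign and flow averages -/

section ParametricIntegralDeriv

variable {E : Type*} [NormedAddCommGroup E] [NormedSpace ℝ E] [FiniteDimensional ℝ E]
  {H : Type*} [TopologicalSpace H] {I : ModelWithCorners ℝ E H} [I.Boundaryless]
  {M : Type*} [TopologicalSpace M] [ChartedSpace H M] [IsManifold I ∞ M]
  {F' : Type*} [NormedAddCommGroup F'] [NormedSpace ℝ F']

/-- **Differentiation under the integral sign on a manifold.** In the setting of
`contMDiffAt_intervalIntegral` (`g` of class `C^∞` on an open `W ⊇ [[a, b]] × {p₀}`), the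
differential of `p ↦ ∫ₐᵇ g (s, p) ds` at `p₀` is the integral of the differentials:
`d(∫ₐᵇ g (s, ·) ds)_{p₀} (v) = ∫ₐᵇ d(g (s, ·))_{p₀} (v) ds`, the integrand being continuous in `s`
(in the chart at `p₀`, after a cutoff, this is `fderiv_parametric_intervalIntegral_apply` of
`Literature/Analysis/FunctionSpaces/SmoothParametricIntegral.lean`, the tangent vector `v` being
read through the differential of the chart). Hörmander, *ALPDO I*, Thm. 1.1.9. [folklore] -/
theorem mvfderiv_intervalIntegral_apply {g : ℝ × M → F'} {W : Set (ℝ × M)} (hW : IsOpen W)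
    (hg : ContMDiffOn (𝓘(ℝ, ℝ).prod I) 𝓘(ℝ, F') ∞ g W) {a b : ℝ} {p₀ : M}
    (hab : ∀ s ∈ uIcc a b, (s, p₀) ∈ W) (v : TangentSpace I p₀) :
    ContinuousOn (fun s ↦ mvfderiv I (fun p ↦ g (s, p)) p₀ v) (uIcc a b) ∧
      mvfderiv I (fun p ↦ ∫ s in a..b, g (s, p)) p₀ v =
        ∫ s in a..b, mvfderiv I (fun p ↦ g (s, p)) p₀ v := by
  -- chart representative of the integrand (as in `contMDiffAt_intervalIntegral`)
  set G : ℝ × E → F' := fun z ↦ g (z.1, (extChartAt I p₀).symm z.2) with hG_def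
  set W' : Set (ℝ × E) :=
    (univ ×ˢ (extChartAt I p₀).target) ∩ (fun z : ℝ × E ↦ (z.1, (extChartAt I p₀).symm z.2)) ⁻¹' W
    with hW'_def
  have hΨc : ContinuousOn (fun z : ℝ × E ↦ (z.1, (extChartAt I p₀).symm z.2))
      (univ ×ˢ (extChartAt I p₀).target) :=
    continuous_fst.continuousOn.prodMk
      ((continuousOn_extChartAt_symm p₀).comp continuous_snd.continuousOn fun z hz ↦ hz.2)
  have hW'o : IsOpen W' :=
    hΨc.isOpen_inter_preimage (isOpen_univ.prod (isOpen_extChartAt_target p₀)) hW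
  have hΨs : ContMDiffOn (𝓘(ℝ, ℝ).prod 𝓘(ℝ, E)) (𝓘(ℝ, ℝ).prod I) ∞
      (fun z : ℝ × E ↦ (z.1, (extChartAt I p₀).symm z.2)) (univ ×ˢ (extChartAt I p₀).target) :=
    contMDiffOn_fst.prodMk ((contMDiffOn_extChartAt_symm p₀).comp contMDiffOn_snd fun z hz ↦ hz.2)
  have hGs : ContMDiffOn (𝓘(ℝ, ℝ).prod 𝓘(ℝ, E)) 𝓘(ℝ, F') ∞ G W' :=
    hg.comp (hΨs.mono inter_subset_left) fun z hz ↦ hz.2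
  have hGs' : ContDiffOn ℝ ∞ G W' := by
    have h : ContMDiffOn 𝓘(ℝ, ℝ × E) 𝓘(ℝ, F') ∞ G W' := by
      rw [modelWithCornersSelf_prod, ← chartedSpaceSelf_prod]; exact hGs
    exact contMDiffOn_iff_contDiffOn.1 h
  have hx₀ : (extChartAt I p₀).symm (extChartAt I p₀ p₀) = p₀ := extChartAt_to_inv p₀
  have hKW' : uIcc a b ×ˢ ({extChartAt I p₀ p₀} : Set E) ⊆ W' := by
    rintro ⟨s, x⟩ ⟨hs, hx⟩
    rw [mem_singleton_iff] at hx
    subst hx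
    refine ⟨⟨mem_univ _, mem_extChartAt_target p₀⟩, ?_⟩
    show (s, (extChartAt I p₀).symm (extChartAt I p₀ p₀)) ∈ W
    rw [hx₀]; exact hab s hs
  obtain ⟨χ, hχ, hχW, hχ1⟩ := exists_contDiff_tsupport_subset_eventually_nhdsSet_eq_one
    (isCompact_uIcc.prod isCompact_singleton) hW'o hKW'
  set Gχ : ℝ × E → F' := fun z ↦ χ z • G z with hGχ_def
  have hGχ : ContDiff ℝ ∞ Gχ := by
    rw [contDiff_iff_contDiffAt]
    intro z
    by_cases hz : z ∈ W'
    · exact hχ.contDiffAt.smul (hGs'.contDiffAt (hW'o.mem_nhds hz))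
    · have hz' : z ∉ tsupport χ := fun h ↦ hz (hχW h)
      have hev : Gχ =ᶠ[𝓝 z] fun _ ↦ (0 : F') := by
        filter_upwards [notMem_tsupport_iff_eventuallyEq.1 hz'] with y hy
        simp [hGχ_def, hy]
      exact (contDiffAt_const (c := (0 : F'))).congr_of_eventuallyEq hev
  have hn : (∞ : ℕ∞ω) ≠ 0 := by simp
  have hInt : ContDiff ℝ ∞ fun x : E ↦ ∫ s in a..b, Gχ (s, x) :=
    Literature.Analysis.FunctionSpaces.contDiff_parametric_intervalIntegral hGχ a b
  obtain ⟨O, hOo, hKO, hOχ⟩ := mem_nhdsSet_iff_exists.1 hχ1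
  obtain ⟨U₁, V₁, -, hV₁, hKU₁, hx₀V₁, hUV⟩ :=
    generalized_tube_lemma isCompact_uIcc isCompact_singleton hOo hKO
  have hx₀V₁' : extChartAt I p₀ p₀ ∈ V₁ := hx₀V₁ (mem_singleton _)
  have hGχG : ∀ s ∈ uIcc a b, ∀ x ∈ V₁, Gχ (s, x) = G (s, x) := by
    intro s hs x hx
    have h1 : χ (s, x) = 1 := hOχ (hUV (mk_mem_prod (hKU₁ hs) hx))
    simp [hGχ_def, h1]
  have hEq : (fun x : E ↦ ∫ s in a..b, G (s, x)) =ᶠ[𝓝 (extChartAt I p₀ p₀)]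
      fun x : E ↦ ∫ s in a..b, Gχ (s, x) := by
    filter_upwards [hV₁.mem_nhds hx₀V₁'] with x hx
    exact intervalIntegral.integral_congr fun s hs ↦ (hGχG s hs x hx).symm
  -- the differential of the chart at `p₀`, and the image `w` of `v`
  have he : HasMFDerivAt I 𝓘(ℝ, E) (extChartAt I p₀) p₀
      (mfderiv I 𝓘(ℝ, E) (extChartAt I p₀) p₀) :=
    ((contMDiffAt_extChartAt (n := ∞)).mdifferentiableAt (by simp)).hasMFDerivAt
  set w : E := mfderiv I 𝓘(ℝ, E) (extChartAt I p₀) p₀ v with hw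
  -- (1) the integral: `d(∫ g)(v) = D(∫ Gχ)(w) = ∫ DGχ (s, x₀) (0, w) ds`
  have hL : HasFDerivAt (fun x : E ↦ ∫ s in a..b, G (s, x))
      (fderiv ℝ (fun x : E ↦ ∫ s in a..b, Gχ (s, x)) (extChartAt I p₀ p₀)) (extChartAt I p₀ p₀) :=
    ((hInt.differentiable (by simp)) _).hasFDerivAt.congr_of_eventuallyEq hEq
  have hEq' : (fun p ↦ ∫ s in a..b, g (s, p)) =ᶠ[𝓝 p₀]
      (fun x : E ↦ ∫ s in a..b, G (s, x)) ∘ extChartAt I p₀ := by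
    filter_upwards [extChartAt_source_mem_nhds (I := I) p₀] with p hp
    simp only [comp_apply, hG_def, (extChartAt I p₀).left_inv hp]
  have h1 : HasMFDerivAt I 𝓘(ℝ, F') (fun p ↦ ∫ s in a..b, g (s, p)) p₀
      ((fderiv ℝ (fun x : E ↦ ∫ s in a..b, Gχ (s, x)) (extChartAt I p₀ p₀)).comp
        (mfderiv I 𝓘(ℝ, E) (extChartAt I p₀) p₀)) :=
    (HasMFDerivAt.comp p₀ hL.hasMFDerivAt he).congr_of_eventuallyEq hEq'
  have hlhs : mvfderiv I (fun p ↦ ∫ s in a..b, g (s, p)) p₀ v =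
      ∫ s in a..b, fderiv ℝ Gχ (s, extChartAt I p₀ p₀) ((0 : ℝ), w) := by
    have e1 : mvfderiv I (fun p ↦ ∫ s in a..b, g (s, p)) p₀ v =
        mfderiv I 𝓘(ℝ, F') (fun p ↦ ∫ s in a..b, g (s, p)) p₀ v := rfl
    rw [e1, h1.mfderiv]
    exact (show ((fderiv ℝ (fun x : E ↦ ∫ s in a..b, Gχ (s, x)) (extChartAt I p₀ p₀)).comp
        (mfderiv I 𝓘(ℝ, E) (extChartAt I p₀) p₀)) v =
        fderiv ℝ (fun x : E ↦ ∫ s in a..b, Gχ (s, x)) (extChartAt I p₀ p₀) w from rfl).trans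
      (Literature.Analysis.FunctionSpaces.fderiv_parametric_intervalIntegral_apply hGχ hn a b _ w)
  -- (2) the integrand at a fixed `s ∈ [[a, b]]`: `d(g (s, ·))(v) = DGχ (s, x₀) (0, w)`
  have hpt : ∀ s ∈ uIcc a b, mvfderiv I (fun p ↦ g (s, p)) p₀ v =
      fderiv ℝ Gχ (s, extChartAt I p₀ p₀) ((0 : ℝ), w) := by
    intro s hs
    have e1 : mvfderiv I (fun p ↦ g (s, p)) p₀ v = mfderiv I 𝓘(ℝ, F') (fun p ↦ g (s, p)) p₀ v :=
      rfl
    have h2 : HasFDerivAt (fun x : E ↦ Gχ (s, x))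
        ((fderiv ℝ Gχ (s, extChartAt I p₀ p₀)).comp (ContinuousLinearMap.inr ℝ ℝ E))
        (extChartAt I p₀ p₀) :=
      Literature.Analysis.FunctionSpaces.hasFDerivAt_comp_prodMk hGχ hn s _
    have h3 : (fun x : E ↦ G (s, x)) =ᶠ[𝓝 (extChartAt I p₀ p₀)] fun x : E ↦ Gχ (s, x) := by
      filter_upwards [hV₁.mem_nhds hx₀V₁'] with x hx
      exact (hGχG s hs x hx).symm
    have h4 : HasFDerivAt (fun x : E ↦ G (s, x))
        ((fderiv ℝ Gχ (s, extChartAt I p₀ p₀)).comp (ContinuousLinearMap.inr ℝ ℝ E))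
        (extChartAt I p₀ p₀) := h2.congr_of_eventuallyEq h3
    have h5 : (fun p ↦ g (s, p)) =ᶠ[𝓝 p₀] (fun x : E ↦ G (s, x)) ∘ extChartAt I p₀ := by
      filter_upwards [extChartAt_source_mem_nhds (I := I) p₀] with p hp
      simp only [comp_apply, hG_def, (extChartAt I p₀).left_inv hp]
    have h6 : HasMFDerivAt I 𝓘(ℝ, F') (fun p ↦ g (s, p)) p₀
        (((fderiv ℝ Gχ (s, extChartAt I p₀ p₀)).comp (ContinuousLinearMap.inr ℝ ℝ E)).comp
          (mfderiv I 𝓘(ℝ, E) (extChartAt I p₀) p₀)) :=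
      (HasMFDerivAt.comp p₀ h4.hasMFDerivAt he).congr_of_eventuallyEq h5
    rw [e1, h6.mfderiv]
    rfl
  refine ⟨?_, ?_⟩
  · have hc : Continuous fun s : ℝ ↦ fderiv ℝ Gχ (s, extChartAt I p₀ p₀) ((0 : ℝ), w) :=
      ((hGχ.continuous_fderiv hn).comp (continuous_id.prodMk continuous_const)).clm_apply
        continuous_const
    exact hc.continuousOn.congr fun s hs ↦ hpt s hs
  · exact hlhs.trans (intervalIntegral.integral_congr fun s hs ↦ (hpt s hs).symm)

end ParametricIntegralDeriv

section FlowAverage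

variable {E : Type*} [NormedAddCommGroup E] [NormedSpace ℝ E] [FiniteDimensional ℝ E]
  {H : Type*} [TopologicalSpace H] {I : ModelWithCorners ℝ E H} [I.Boundaryless]
  {M : Type*} [TopologicalSpace M] [ChartedSpace H M] [IsManifold I ∞ M]
  {θ : ℝ × M → M}

/-- **Averaging a function along a flow.** Let `θ` be a `C^∞` complete flow (group law,
`θ₀ = id`), `U` an open `θ`-invariant set and `τ' : M → ℝ` of class `C^∞` on `U`. Then the flow
average `t̄ (p) = ∫₀ᵀ τ' (θ (s, p)) ds` is `C^∞` on `U` (`contMDiffAt_intervalIntegral`); its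
differential is the average of the transported differentials,
`dt̄_p (v) = ∫₀ᵀ dτ'_{θ_s p} (d(θ_s)_p v) ds` with continuous integrand
(`mvfderiv_intervalIntegral_apply` and the chain rule); and its derivative along the flow is the
difference of the end values, `(d/dr) t̄ (θ (r, p))|₀ = τ' (θ (T, p)) - τ' (p)` (the substitution
`s ↦ s + r` and the fundamental theorem of calculus). This is the device by which a function is
made monotone along the orbits while keeping control of its differential (cf. the averaging over
the isometry group in Chruściel–Costa 2008, §4.2, "Averaging over `𝕋^{s-1}` … we obtain a new time
function `t̂`"). [folklore] -/
theorem flowAverage (hθ : ContMDiff (𝓘(ℝ, ℝ).prod I) I ∞ θ) (hθ0 : ∀ p, θ (0, p) = p)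
    (hθadd : ∀ t s p, θ (t, θ (s, p)) = θ (t + s, p)) {U : Set M} (hU : IsOpen U)
    (hUinv : ∀ (s : ℝ) (p : M), p ∈ U → θ (s, p) ∈ U) {τ' : M → ℝ}
    (hτ' : ContMDiffOn I 𝓘(ℝ, ℝ) ∞ τ' U) (T : ℝ) :
    ContMDiffOn I 𝓘(ℝ, ℝ) ∞ (fun p ↦ ∫ s in (0 : ℝ)..T, τ' (θ (s, p))) U ∧
      (∀ p ∈ U, ∀ v : TangentSpace I p,
        ContinuousOn (fun s ↦ mvfderiv I τ' (θ (s, p))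
          (mfderiv I I (fun q ↦ θ (s, q)) p v)) (uIcc 0 T) ∧
        mvfderiv I (fun p ↦ ∫ s in (0 : ℝ)..T, τ' (θ (s, p))) p v =
          ∫ s in (0 : ℝ)..T, mvfderiv I τ' (θ (s, p)) (mfderiv I I (fun q ↦ θ (s, q)) p v)) ∧
      ∀ p ∈ U, HasDerivAt (fun r ↦ ∫ s in (0 : ℝ)..T, τ' (θ (s, θ (r, p))))
        (τ' (θ (T, p)) - τ' p) 0 := by
  -- the integrand `g (s, p) = τ' (θ (s, p))` is smooth on the open set `θ ⁻¹' U`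
  set W : Set (ℝ × M) := θ ⁻¹' U with hW_def
  have hW : IsOpen W := hU.preimage hθ.continuous
  have hg : ContMDiffOn (𝓘(ℝ, ℝ).prod I) 𝓘(ℝ, ℝ) ∞ (fun z : ℝ × M ↦ τ' (θ z)) W :=
    hτ'.comp hθ.contMDiffOn fun z hz ↦ hz
  have hmem : ∀ p ∈ U, ∀ s ∈ uIcc (0 : ℝ) T, (s, p) ∈ W := fun p hp s _ ↦ hUinv s p hp
  -- chain rule for the integrand at fixed `s`
  have hchain : ∀ p ∈ U, ∀ (s : ℝ) (v : TangentSpace I p),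
      mvfderiv I (fun q ↦ τ' (θ (s, q))) p v =
        mvfderiv I τ' (θ (s, p)) (mfderiv I I (fun q ↦ θ (s, q)) p v) := by
    intro p hp s v
    have hθs : MDifferentiableAt I I (fun q ↦ θ (s, q)) p :=
      (hθ.contMDiffAt.comp p (contMDiffAt_const.prodMk contMDiffAt_id)).mdifferentiableAt (by simp)
    have hτ's : MDifferentiableAt I 𝓘(ℝ, ℝ) τ' (θ (s, p)) :=
      (hτ'.contMDiffAt (hU.mem_nhds (hUinv s p hp))).mdifferentiableAt (by simp)
    have hc : HasMFDerivAt I 𝓘(ℝ, ℝ) (τ' ∘ fun q ↦ θ (s, q)) p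
        ((mfderiv I 𝓘(ℝ, ℝ) τ' (θ (s, p))).comp (mfderiv I I (fun q ↦ θ (s, q)) p)) :=
      HasMFDerivAt.comp p hτ's.hasMFDerivAt hθs.hasMFDerivAt
    exact congrArg
      (fun L : TangentSpace I p →L[ℝ] TangentSpace 𝓘(ℝ, ℝ) (τ' (θ (s, p))) ↦ L v) hc.mfderiv
  refine ⟨fun p hp ↦ ?_, fun p hp v ↦ ?_, fun p hp ↦ ?_⟩
  · exact (contMDiffAt_intervalIntegral (I := I) hW hg (hmem p hp)).contMDiffWithinAt
  · obtain ⟨hc, hd⟩ := mvfderiv_intervalIntegral_apply (I := I) hW hg (hmem p hp) v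
    refine ⟨hc.congr fun s _ ↦ (hchain p hp s v).symm, ?_⟩
    rw [hd]
    exact intervalIntegral.integral_congr fun s _ ↦ hchain p hp s v
  · -- derivative along the flow: substitute `s ↦ s + r` and differentiate the limits
    set φ : ℝ → ℝ := fun s ↦ τ' (θ (s, p)) with hφ_def
    have hφc : Continuous φ :=
      hτ'.continuousOn.comp_continuous (hθ.continuous.comp (continuous_id.prodMk continuous_const))
        fun s ↦ hUinv s p hp
    have h1 : (fun r ↦ ∫ s in (0 : ℝ)..T, τ' (θ (s, θ (r, p)))) =
        fun r ↦ (∫ s in (0 : ℝ)..(T + r), φ s) - ∫ s in (0 : ℝ)..r, φ s := by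
      funext r
      have h2 : (∫ s in (0 : ℝ)..T, τ' (θ (s, θ (r, p)))) = ∫ s in (0 + r)..(T + r), φ s := by
        rw [← intervalIntegral.integral_comp_add_right φ r]
        simp only [hφ_def, hθadd]
      rw [h2, zero_add, intervalIntegral.integral_interval_sub_left (hφc.intervalIntegrable _ _)
        (hφc.intervalIntegrable _ _)]
    rw [h1]
    have hA : HasDerivAt (fun r ↦ ∫ s in (0 : ℝ)..(T + r), φ s) (φ T) 0 := by
      have h := (hφc.integral_hasStrictDerivAt 0 (T + 0)).hasDerivAt.comp_const_add T 0
      simp only [add_zero] at h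
      exact h
    have hB : HasDerivAt (fun r ↦ ∫ s in (0 : ℝ)..r, φ s) (φ 0) 0 :=
      (hφc.integral_hasStrictDerivAt 0 0).hasDerivAt
    have hC := hA.sub hB
    simp only [hφ_def, hθ0] at hC
    exact hC

end FlowAverage

/-! ### Assembly: the fact from a time function on `⟨⟨M_ext⟩⟩` and the smoothing of causal functions -/

/-- **Chruściel–Costa 2008, Thm. 4.5 (the time-function part with spacelike level sets), reduced to
two classical theorems of causality theory.**  Assume (for `4`-dimensional space-times and open
sets `N`): (`hGH`) every globally hyperbolic open set `N` (Hawking–Ellis, §6.6) carries a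
continuous time function — a function strictly increasing along the future causal curves in `N`
(Geroch 1970; Hawking–Ellis 1973, Prop. 6.6.8; Minguzzi 2019, Thm. 4.119); and (`hBS`) on an open
set carrying a time function, every continuous causal (isotone) function is uniformly approximable
by smooth temporal functions (Bernard–Suhr 2018, Cor. 9).  Then the named fact
`chruscielCosta2008_spacelikeTimeFunction` holds.  Proof: for a vacuum `I⁺`-regular `𝓑` with
stationary flow `θ`, let `u` be the retarded Killing time of `⟨⟨M_ext⟩⟩`
(`IsIPlusRegular.exists_continuousOn_retardedTime`: continuous, `u ∘ θ_s = u + s`, isotone); by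
`hGH` (global hyperbolicity of `⟨⟨M_ext⟩⟩`, Def. 1.1) and `hBS` there is a smooth temporal `τ'` on
`⟨⟨M_ext⟩⟩` with `|τ' - u| < 1/8`; its flow average `t̄ = ∫₀¹ τ' ∘ θ_s ds` (`flowAverage`) is smooth on
`⟨⟨M_ext⟩⟩`, has `dt̄(K) = τ' ∘ θ₁ - τ' > 1 - 2/8 > 0`, has `dt̄(k) = ∫₀¹ dτ'(dθ_s k) ds > 0` for
future-directed causal `k` (the flow maps preserve the future causal cone,
`IsKillingField.isFutureDirected_mfderiv_flow`) and `< 0` for past-directed ones, and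
`|t̄ - u - 1/2| ≤ 1/8`, so that along every orbit `s ↦ t̄ (θ_s p)` is strictly increasing from
negative to positive values: `𝒮₀ := {t̄ = 0} ∩ ⟨⟨M_ext⟩⟩` is a smooth spacelike section of the flow
met exactly once by every orbit, and `chruscielCosta2008_spacelikeTimeFunction_of_sections`
concludes.  This replaces the `C⁺_ε`-smoothing of §4.2 (Lemmas 4.7–4.9, which need Prop. 4.4 and
the one-end hypothesis) by the smoothing theory of causal functions; the vacuum hypothesis is not
used. [cite: ChruscielCosta2008, Thm. 4.5] -/
theorem chruscielCosta2008_spacelikeTimeFunction_of_timeFunction_approx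
    (hGH : ∀ (𝓢 : Spacetime.{0} 4) (N : Set 𝓢.carrier), IsOpen N → 𝓢.IsGloballyHyperbolicSet N →
      ∃ t : 𝓢.carrier → ℝ, ContinuousOn t N ∧
        ∀ (γ : ℝ → 𝓢.carrier) (a b : ℝ), a < b →
          𝓢.metric.IsFutureCausalCurveOn 𝓢.timeOrientation γ (Icc a b) →
          (∀ s ∈ Icc a b, γ s ∈ N) → t (γ a) < t (γ b))
    (hBS : ∀ (𝓢 : Spacetime.{0} 4) (N : Set 𝓢.carrier), IsOpen N →
      (∃ t : 𝓢.carrier → ℝ, ContinuousOn t N ∧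
        ∀ (γ : ℝ → 𝓢.carrier) (a b : ℝ), a < b →
          𝓢.metric.IsFutureCausalCurveOn 𝓢.timeOrientation γ (Icc a b) →
          (∀ s ∈ Icc a b, γ s ∈ N) → t (γ a) < t (γ b)) →
      ∀ f : 𝓢.carrier → ℝ, ContinuousOn f N →
        (∀ (γ : ℝ → 𝓢.carrier) (a b : ℝ), a < b →
          𝓢.metric.IsFutureCausalCurveOn 𝓢.timeOrientation γ (Icc a b) →
          (∀ s ∈ Icc a b, γ s ∈ N) → f (γ a) ≤ f (γ b)) →
        ∀ ε : ℝ, 0 < ε →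
          ∃ τ' : 𝓢.carrier → ℝ, ContMDiffOn (𝓡 4) 𝓘(ℝ, ℝ) ∞ τ' N ∧
            (∀ x ∈ N, ∀ v : TangentSpace (𝓡 4) x,
              𝓢.timeOrientation.IsFutureDirected v → 0 < mvfderiv (𝓡 4) τ' x v) ∧
            ∀ x ∈ N, |τ' x - f x| < ε) :
    chruscielCosta2008_spacelikeTimeFunction := by
  refine chruscielCosta2008_spacelikeTimeFunction_of_sections fun 𝓑 _ _ hreg θ hθ hθ0 hθadd hθX ↦ ?_
  have hK : 𝓑.metric.IsKillingField 𝓑.killing := 𝓑.isStationaryKilling.isKillingField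
  have hθ2 : ContMDiff (𝓘(ℝ, ℝ).prod (𝓡 4)) (𝓡 4) 2 θ := hθ.of_le (WithTop.coe_le_coe.mpr le_top)
  have hD : IsOpen 𝓑.doc :=
    𝓑.isOpen_doc LorentzianMetric.isOpen_chronologicalFuture_holds_of_boundaryless
      LorentzianMetric.isOpen_chronologicalPast_holds_of_boundaryless
  have hDinv : ∀ (s : ℝ) (p : 𝓑.carrier), p ∈ 𝓑.doc → θ (s, p) ∈ 𝓑.doc := by
    intro s p hp
    have h0 : (fun t ↦ θ (t, p)) 0 ∈ 𝓑.doc := by simpa only [hθ0] using hp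
    exact StationaryAFBlackHole.mem_doc_of_isMIntegralCurve (hθX p) h0 s
  -- (1) the retarded Killing time `u`
  obtain ⟨u, hu, hueq, humono⟩ := hreg.exists_continuousOn_retardedTime hθ hθ0 hθadd hθX
  have humono' : ∀ (γ : ℝ → 𝓑.carrier) (a b : ℝ), a < b →
      𝓑.metric.IsFutureCausalCurveOn 𝓑.timeOrientation γ (Icc a b) →
      (∀ s ∈ Icc a b, γ s ∈ 𝓑.doc) → u (γ a) ≤ u (γ b) := by
    intro γ a b hab hγ hγD
    exact humono _ (hγD a ⟨le_rfl, hab.le⟩) _ (hγD b ⟨hab.le, le_rfl⟩)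
      (Or.inr ⟨γ a, rfl, γ, a, b, hab, hγ, rfl, rfl⟩)
  -- (2) a time function on `⟨⟨M_ext⟩⟩` (global hyperbolicity), (3) a smooth temporal `τ'` near `u`
  have htime := hGH 𝓑.toSpacetime 𝓑.doc hD hreg.isGloballyHyperbolicSet_doc
  obtain ⟨τ', hτ's, hτ'pos, hτ'u⟩ :=
    hBS 𝓑.toSpacetime 𝓑.doc hD htime u hu humono' (1 / 8) (by norm_num)
  -- (4) the flow average `tb = ∫₀¹ τ' ∘ θ_s ds`
  obtain ⟨htbs, htbd, htbflow⟩ := flowAverage (I := 𝓡 4) hθ hθ0 hθadd hD hDinv hτ's 1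
  set tb : 𝓑.carrier → ℝ := fun p ↦ ∫ s in (0 : ℝ)..1, τ' (θ (s, p)) with htb_def
  -- the Killing derivative of `tb` exceeds `3/4`
  have hKt : ∀ p ∈ 𝓑.doc, 3 / 4 < τ' (θ (1, p)) - τ' p := by
    intro p hp
    have h1 := abs_lt.1 (hτ'u p hp)
    have h2 := abs_lt.1 (hτ'u _ (hDinv 1 p hp))
    have h3 := hueq p hp 1
    linarith [h1.1, h1.2, h2.1, h2.2]
  -- `tb` is within `1/8` of `u + 1/2`
  have htbb : ∀ q ∈ 𝓑.doc, |tb q - (u q + 1 / 2)| ≤ 1 / 8 := by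
    intro q hq
    have hc1 : Continuous fun s : ℝ ↦ τ' (θ (s, q)) :=
      hτ's.continuousOn.comp_continuous (hθ.continuous.comp (continuous_id.prodMk continuous_const))
        fun s ↦ hDinv s q hq
    have hint1 : IntervalIntegrable (fun s : ℝ ↦ τ' (θ (s, q))) MeasureTheory.volume 0 1 :=
      hc1.intervalIntegrable 0 1
    have hint2 : IntervalIntegrable (fun s : ℝ ↦ u q + s) MeasureTheory.volume 0 1 :=
      (continuous_const.add continuous_id).intervalIntegrable 0 1
    have h0 : ∫ s in (0 : ℝ)..1, (u q + s) = u q + 1 / 2 := by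
      rw [intervalIntegral.integral_add (f := fun _ ↦ u q) (g := fun s : ℝ ↦ s) intervalIntegrable_const
        (continuous_id.intervalIntegrable 0 1), intervalIntegral.integral_const, integral_id]
      norm_num
    have h1 : tb q - (u q + 1 / 2) = ∫ s in (0 : ℝ)..1, (τ' (θ (s, q)) - (u q + s)) := by
      rw [intervalIntegral.integral_sub hint1 hint2, h0]
    rw [h1]
    have h2 : ‖∫ s in (0 : ℝ)..1, (τ' (θ (s, q)) - (u q + s))‖ ≤ 1 / 8 * |(1 : ℝ) - 0| := by
      refine intervalIntegral.norm_integral_le_of_norm_le_const fun s hs ↦ ?_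
      have hs' : s ∈ Ioc (0 : ℝ) 1 := by simpa using hs
      rw [Real.norm_eq_abs, ← hueq q hq s]
      exact (hτ'u _ (hDinv s q hq)).le
    simpa using h2
  -- the section
  refine ⟨{x | x ∈ 𝓑.doc ∧ tb x = 0}, fun x hx ↦ ?_, fun p hp ↦ ?_⟩
  · -- local (indeed global on the d.o.c.) defining function `tb`
    have htbx : ContMDiffAt (𝓡 4) 𝓘(ℝ, ℝ) ∞ tb x := htbs.contMDiffAt (hD.mem_nhds hx.1)
    refine ⟨tb, 𝓑.doc, hD, hx.1, htbx, fun y hy ↦ ⟨fun h ↦ h.2, fun h ↦ ⟨hy, h⟩⟩, ?_, ?_⟩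
    · rw [mfderiv_apply_eq_of_hasDerivAt_flow hθX hθ0 (htbx.mdifferentiableAt (by simp))
        (htbflow x hx.1)]
      intro h
      have h' : @Eq ℝ (τ' (θ (1, x)) - τ' x) 0 := h
      have h3 := hKt x hx.1
      rw [h'] at h3
      norm_num at h3
    · -- spacelike level sets: `dtb (k) = ∫₀¹ dτ' (dθ_s k) ds` has a sign on causal `k`
      have hpos : ∀ w : TangentSpace (𝓡 4) x, 𝓑.timeOrientation.IsFutureDirected w →
          0 < mvfderiv (𝓡 4) tb x w := by
        intro w hw
        obtain ⟨hc, hd⟩ := htbd x hx.1 w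
        rw [hd]
        refine intervalIntegral.intervalIntegral_pos_of_pos_on hc.intervalIntegrable
          (fun s _ ↦ ?_) zero_lt_one
        exact hτ'pos _ (hDinv s x hx.1) _ (hK.isFutureDirected_mfderiv_flow hθ2 hθ0 hθadd hθX s hw)
      intro k hk hk0 h0
      have h0' : mvfderiv (𝓡 4) tb x k = 0 := h0
      rcases 𝓑.timeOrientation.isFutureDirected_or_isPastDirected_of_isCausal ⟨hk, hk0⟩ with hf | hp'
      · exact (hpos k hf).ne' h0'
      · have h1 := hpos (-k) ((𝓑.timeOrientation.isFutureDirected_neg_iff k).2 hp')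
        rw [map_neg, h0', neg_zero] at h1
        exact lt_irrefl _ h1
  · -- every orbit through the d.o.c. meets `{tb = 0}` exactly once
    set G : ℝ → ℝ := fun s ↦ tb (θ (s, p)) with hG_def
    have hGd : ∀ s, HasDerivAt G (τ' (θ (1, θ (s, p))) - τ' (θ (s, p))) s := by
      intro s
      have h := htbflow (θ (s, p)) (hDinv s p hp)
      have h' : HasDerivAt (fun r ↦ G (r + s)) (τ' (θ (1, θ (s, p))) - τ' (θ (s, p))) (s - s) := by
        rw [sub_self]
        have hfun : (fun r ↦ G (r + s)) = fun r ↦ ∫ s₁ in (0 : ℝ)..1, τ' (θ (s₁, θ (r, θ (s, p)))) := by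
          funext r
          simp only [hG_def, htb_def, hθadd]
        rw [hfun]
        exact h
      have h'' := h'.comp_sub_const s s
      simpa only [sub_add_cancel] using h''
    have hGmono : StrictMono G := by
      refine strictMono_of_deriv_pos fun s ↦ ?_
      rw [(hGd s).deriv]
      linarith [hKt _ (hDinv s p hp)]
    have hGc : Continuous G := continuous_iff_continuousAt.2 fun s ↦ (hGd s).continuousAt
    have hGb : ∀ s, |G s - (u p + s + 1 / 2)| ≤ 1 / 8 := by
      intro s
      have h := htbb _ (hDinv s p hp)
      rwa [hueq p hp s] at h
    -- existence of a zero, by the intermediate value theorem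
    have hlo : G (-(u p) - 1 / 2 - 1) < 0 := by
      have h := abs_le.1 (hGb (-(u p) - 1 / 2 - 1))
      linarith [h.2]
    have hhi : 0 < G (-(u p) - 1 / 2 + 1) := by
      have h := abs_le.1 (hGb (-(u p) - 1 / 2 + 1))
      linarith [h.1]
    obtain ⟨s₀, -, hs₀⟩ : (0 : ℝ) ∈ G '' Icc (-(u p) - 1 / 2 - 1) (-(u p) - 1 / 2 + 1) :=
      intermediate_value_Icc (by linarith) hGc.continuousOn ⟨hlo.le, hhi.le⟩
    refine ⟨s₀, ⟨hDinv s₀ p hp, hs₀⟩, fun s hs ↦ hGmono.injective (hs.2.trans hs₀.symm)⟩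


/-- **Chruściel–Costa 2008, Thm. 4.5, from the smoothing theorem alone.** Geroch's time function
on an open Hawking–Ellis globally hyperbolic set is now a theorem of the tree
(`LorentzianMetric.IsGloballyHyperbolicSet.exists_timeFunction`, discharging the hypothesis `hGH`
of `chruscielCosta2008_spacelikeTimeFunction_of_timeFunction_approx`), so the named fact
`chruscielCosta2008_spacelikeTimeFunction` follows from the single remaining classical input: the
uniform smoothing of continuous causal functions on an open region carrying a time function
(Bernard–Suhr 2018, Cor. 9, here as the hypothesis `hBS` for four-dimensional spacetimes).
[cite: ChruscielCosta2008, Thm. 4.5 (arXiv v2, p. 13)] -/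
theorem chruscielCosta2008_spacelikeTimeFunction_of_smoothing
    (hBS : ∀ (𝓢 : Spacetime.{0} 4) (N : Set 𝓢.carrier), IsOpen N →
      (∃ t : 𝓢.carrier → ℝ, ContinuousOn t N ∧
        ∀ (γ : ℝ → 𝓢.carrier) (a b : ℝ), a < b →
          𝓢.metric.IsFutureCausalCurveOn 𝓢.timeOrientation γ (Icc a b) →
          (∀ s ∈ Icc a b, γ s ∈ N) → t (γ a) < t (γ b)) →
      ∀ f : 𝓢.carrier → ℝ, ContinuousOn f N →
        (∀ (γ : ℝ → 𝓢.carrier) (a b : ℝ), a < b →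
          𝓢.metric.IsFutureCausalCurveOn 𝓢.timeOrientation γ (Icc a b) →
          (∀ s ∈ Icc a b, γ s ∈ N) → f (γ a) ≤ f (γ b)) →
        ∀ ε : ℝ, 0 < ε → ∃ τ' : 𝓢.carrier → ℝ, ContMDiffOn (𝓡 4) 𝓘(ℝ, ℝ) ∞ τ' N ∧
            (∀ x ∈ N, ∀ v : TangentSpace (𝓡 4) x,
              𝓢.timeOrientation.IsFutureDirected v → 0 < mvfderiv (𝓡 4) τ' x v) ∧
            ∀ x ∈ N, |τ' x - f x| < ε) :
    chruscielCosta2008_spacelikeTimeFunction :=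
  chruscielCosta2008_spacelikeTimeFunction_of_timeFunction_approx
    (fun 𝓢 _ hNo hN ↦
      LorentzianMetric.IsGloballyHyperbolicSet.exists_timeFunction (g := 𝓢.metric)
        (τ := 𝓢.timeOrientation) (WithTop.coe_le_coe.mpr le_top) hN hNo)
    hBS

end Literature.Geometry.Lorentzian

end
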